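import Literature.MathematicalPhysics.QuantumLattice.CentreSymmetry
import Literature.MathematicalPhysics.QuantumLattice.LatticeGaugeDLRSymmetry
import Literature.MathematicalPhysics.QuantumFieldTheory.LatticeGaugeShenZhuZhuProofs
import HarnessLib

/-!
# Chatterjee's «unbroken centre symmetry implies confinement» (CMP 385 (2021), Thm. 2.2): proofs

Sibling proof file of `Literature/MathematicalPhysics/QuantumLattice/CentreSymmetry.lean` (same
namespace). It DISCHARGES the named fact `chatterjee2021_confinement_of_centreUnbroken`
(Chatterjee 2021, **Theorem 2.2**, «unbroken center symmetry implies confinement») as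
`chatterjee2021_confinement_of_centreUnbroken_holds`, following the printed proof, op. cit. §3
(pp. 1014–1016; chunks `p0008`–`p0009` of the held text `paper:arxiv-2006.16229`):

* Schur: for `g₀ ∈ Z(G)` with `π(g₀) ≠ 1` and `π` irreducible, `π(g₀) = c·1` with `c ≠ 1`
  (tree: `SymmetryAdapted.exists_eq_smul_one_of_comm`).
* **Lemma 3.1** (`colKernel_tendsto_zero`, `colSup_eventually_le`): for the finite slabs
  `S_R = {0,…,N} × {−R,…,R}^{d−1}` with ANY boundary condition, the kernel expectations of the
  vertical chain variables through the origin tend to `0` as `R → ∞`, uniformly in the boundary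
  condition («`lim_{R→∞} sup_{f,δ} |⟨f⟩_{R,δ}| = 0`»). Printed proof, followed here: by
  contradiction, compactness (Prokhorov on the compact metrisable configuration space — Mathlib's
  compactness of `ProbabilityMeasure` — and of the space of boundary conditions), «the limit law
  is easily verified to be a Gibbs measure for our lattice gauge theory on `S` with boundary
  condition `δ`» (consistency of the kernels, Feller continuity, bounded continuous functions
  determine a finite measure; concentration on `{U = δ off the interior edges}` by properness),
  and the centre transform multiplies the chain variable by `c ≠ 1` while leaving the slab Gibbs
  measure invariant.
* **Lemma 3.2** (`matrixIntegral_prod_eq_prod`: conditioning on the faces of consecutive slabs of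
  thickness `N` makes them independent — consistency, properness and finite range of the Wilson
  kernels) and the **proof of Theorem 2.2** (`norm_integral_trace_rect_le`: condition on the
  boundary and the outside of a translate of `{0,…,T} × {−R,…,R}^{d−1}` having one vertical side of
  the loop through its centre; each of the `[T/N]` slab blocks contributes a factor `≤ m·s(R)` by
  translation covariance of the kernels, `integral_blockObs_eq`).
* Assembly (`chatterjee2021_confinement_of_centreUnbroken_holds`): `V(R) := −log s(R)` and
  `V₁(R) = V(R)/2N − 3 log m` (`R ≥ N`), `−log m` (`R < N`); loops whose long side is not along
  `e₀` are moved by a coordinate permutation (`map_relabel_edgePerm_mem_ymGibbsMeasures`,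
  `walkHolonomy_relabel_edgePerm_rectWalk` from `LatticeGaugeDLRSymmetry.lean`) — the hypothesis
  `CentreUnbroken` (Def. 2.1) is pinned to the coordinate direction `0`, and the printed proof
  uses the isotropy of the theory tacitly.

Rendering (bookkeeping deviations from the printed text, mathematically equivalent):
(a) instead of the `m^{2N}` scalar «chain variables» we use the `m × m` matrix
`col(U; y, n) = π(U_{(y,0)}) π(U_{(y+e₀,0)}) ⋯ π(U_{(y+(n−1)e₀,0)})` of the vertical column (its
entries are sums of chain variables; `col ∘ τ_{g₀} = c · col`); accordingly the printed constant
`m^{2(R+T)}` becomes `m^{[T/N]+2}` and `4 log m` becomes `3 log m`;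
(b) the finite slab with boundary condition `η` is the tree's DLR kernel
`ymSpecification ρ β (slabBox N R) η`, `slabBox N R` = the interior slab edges whose endpoints have
all lateral coordinates in `[−(R−1), R−1]` (these exhaust the interior edges as `R → ∞`; the printed
weighted-average step is the consistency of the specification);
(c) in the proof of Thm. 2.2 the partial top slab of thickness `T − N[T/N]` is kept frozen rather
than resampled (its chain variable is bounded by `1` either way);
(d) for `R ≤ T < N` the printed bound `m^{4T} e^{−V(R)T/2N}` rests on `[x] ≥ x/2` with
`x = T/N < 1`; only the trivial bound `|⟨W_ℓ⟩| ≤ m` is available there, which is what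
`V₁(R) = −log m` for `R < N` encodes (the theorem only asks for SOME `V₁ → ∞`).

No named fact (`Prop`-valued hypothesis) is introduced; every statement is proved (D-0026). The
`def`s `matrixIntegral`, `colMat`, `colEdges`, `slabBox`, `slabBlockBase`, `blockEdges`, `blocksUnion`,
`lineHol`, `colSup` are plumbing for the proof.

## References

* S. Chatterjee, *A probabilistic mechanism for quark confinement*, Commun. Math. Phys. **385**
  (2021) 1007–1039, arXiv:2006.16229, §3 (proof of Thm. 2.2: Lemma 3.1, Lemma 3.2). [Chatterjee2021]
* H.-O. Georgii, *Gibbs Measures and Phase Transitions*, 2nd ed. (2011), Def. 1.23, Thm. 4.17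
  (limits of finite-volume Gibbs distributions with boundary conditions are Gibbs measures).
  [Georgii2011]
-/

noncomputable section

open MeasureTheory Filter Topology
open Literature.Probability.LatticeModels

namespace Literature.MathematicalPhysics.QuantumLattice

/-! ### Matrix bookkeeping: entry bounds for products and traces -/

section MatrixBounds

variable {m : ℕ}

/-- Entries of a product of two matrices with entries bounded by `x`, `y` are bounded by `m·x·y`. [folklore] -/
private theorem norm_mul_apply_le {X Y : Matrix (Fin m) (Fin m) ℂ} {x y : ℝ}
    (hX : ∀ a b, ‖X a b‖ ≤ x) (hY : ∀ a b, ‖Y a b‖ ≤ y) (a b : Fin m) :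
    ‖(X * Y) a b‖ ≤ m * (x * y) := by
  rw [Matrix.mul_apply]
  calc ‖∑ c, X a c * Y c b‖ ≤ ∑ c, ‖X a c * Y c b‖ := norm_sum_le _ _
    _ ≤ ∑ _c : Fin m, x * y := Finset.sum_le_sum fun c _ => by
        rw [norm_mul]
        exact mul_le_mul (hX a c) (hY c b) (norm_nonneg _) ((norm_nonneg _).trans (hX a c))
    _ = m * (x * y) := by simp

/-- The trace of a matrix with entries bounded by `x` is bounded by `m·x`. [folklore] -/
private theorem norm_trace_le {X : Matrix (Fin m) (Fin m) ℂ} {x : ℝ} (hX : ∀ a b, ‖X a b‖ ≤ x) :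
    ‖X.trace‖ ≤ m * x := by
  simp only [Matrix.trace, Matrix.diag]
  calc ‖∑ i, X i i‖ ≤ ∑ i, ‖X i i‖ := norm_sum_le _ _
    _ ≤ ∑ _i : Fin m, x := Finset.sum_le_sum fun i _ => hX i i
    _ = m * x := by simp

/-- Entries of the identity matrix are bounded by `1`. [folklore] -/
private theorem norm_one_apply_le_one (a b : Fin m) : ‖(1 : Matrix (Fin m) (Fin m) ℂ) a b‖ ≤ 1 := by
  rw [Matrix.one_apply]
  split_ifs <;> simp

/-- Entries of a product of `ℓ` matrices with entries bounded by `x ≥ 0` are bounded by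
`m^ℓ x^ℓ`. [folklore] -/
private theorem norm_list_prod_apply_le {x : ℝ} (hx : 0 ≤ x) :
    ∀ (L : List (Matrix (Fin m) (Fin m) ℂ)), (∀ X ∈ L, ∀ a b, ‖X a b‖ ≤ x) →
      ∀ a b, ‖L.prod a b‖ ≤ (m : ℝ) ^ L.length * x ^ L.length
  | [], _, a, b => by
      simpa only [List.prod_nil, List.length_nil, pow_zero, mul_one] using norm_one_apply_le_one a b
  | X :: L, h, a, b => by
      rw [List.prod_cons, List.length_cons, pow_succ, pow_succ]
      have hX := h X List.mem_cons_self
      have hL := norm_list_prod_apply_le hx L (fun Y hY => h Y (List.mem_cons_of_mem _ hY))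
      calc ‖(X * L.prod) a b‖ ≤ m * (x * ((m : ℝ) ^ L.length * x ^ L.length)) :=
            norm_mul_apply_le hX hL a b
        _ = (m : ℝ) ^ L.length * m * (x ^ L.length * x) := by ring

end MatrixBounds

/-! ### Entrywise integrals of matrix-valued observables -/

section MatrixIntegral

variable {m : ℕ} {X : Type*} [MeasurableSpace X]

/-- The entrywise integral of a matrix-valued function. [folklore] -/
def matrixIntegral (μ : Measure X) (F : X → Matrix (Fin m) (Fin m) ℂ) : Matrix (Fin m) (Fin m) ℂ :=
  Matrix.of fun a b => ∫ x, F x a b ∂μ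

/-- Entries of the entrywise integral. [folklore] -/
@[simp] private theorem matrixIntegral_apply (μ : Measure X) (F : X → Matrix (Fin m) (Fin m) ℂ)
    (a b : Fin m) : matrixIntegral μ F a b = ∫ x, F x a b ∂μ := rfl

/-- `∫ F·C = (∫ F)·C` for a constant matrix `C`. [folklore] -/
private theorem matrixIntegral_mul_const (μ : Measure X) {F : X → Matrix (Fin m) (Fin m) ℂ}
    (hF : ∀ a b, Integrable (fun x => F x a b) μ) (C : Matrix (Fin m) (Fin m) ℂ) :
    matrixIntegral μ (fun x => F x * C) = matrixIntegral μ F * C := by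
  ext a b
  simp only [matrixIntegral_apply, Matrix.mul_apply]
  rw [integral_finsetSum _ fun c _ => (hF a c).mul_const _]
  exact Finset.sum_congr rfl fun c _ => integral_mul_const _ _

/-- `∫ C·F = C·(∫ F)` for a constant matrix `C`. [folklore] -/
private theorem matrixIntegral_const_mul (μ : Measure X) {F : X → Matrix (Fin m) (Fin m) ℂ}
    (hF : ∀ a b, Integrable (fun x => F x a b) μ) (C : Matrix (Fin m) (Fin m) ℂ) :
    matrixIntegral μ (fun x => C * F x) = C * matrixIntegral μ F := by
  ext a b
  simp only [matrixIntegral_apply, Matrix.mul_apply]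
  rw [integral_finsetSum _ fun c _ => (hF c b).const_mul _]
  exact Finset.sum_congr rfl fun c _ => integral_const_mul _ _

/-- `∫ tr F = tr ∫ F`. [folklore] -/
private theorem integral_trace_eq (μ : Measure X) {F : X → Matrix (Fin m) (Fin m) ℂ}
    (hF : ∀ a b, Integrable (fun x => F x a b) μ) :
    ∫ x, (F x).trace ∂μ = (matrixIntegral μ F).trace := by
  simp only [Matrix.trace, Matrix.diag, matrixIntegral_apply]
  exact integral_finsetSum _ fun i _ => hF i i

/-- Entries of the entrywise integral of a function with entries bounded by `c` against a
probability measure are bounded by `c`. [folklore] -/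
private theorem norm_matrixIntegral_apply_le (μ : Measure X) [IsProbabilityMeasure μ]
    {F : X → Matrix (Fin m) (Fin m) ℂ} {c : ℝ} (hF : ∀ x a b, ‖F x a b‖ ≤ c) (a b : Fin m) :
    ‖matrixIntegral μ F a b‖ ≤ c := by
  rw [matrixIntegral_apply]
  have h := norm_integral_le_of_norm_le_const (μ := μ) (f := fun x => F x a b) (C := c)
    (ae_of_all _ fun x => hF x a b)
  simpa using h

end MatrixIntegral

/-! ### Consistency and DLR equations for vector-valued observables -/

section Consistency

open ProbabilityTheory

variable {V S E : Type*} [MeasurableSpace S] [NormedAddCommGroup E] [NormedSpace ℝ E]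

/-- Consistency of a specification for vector-valued observables: for `Λ ⊆ Λ'`,
`∫ (∫ f dγ_Λ(·|σ)) dγ_{Λ'}(·|η)(σ) = ∫ f dγ_{Λ'}(·|η)` (Georgii 2011, Def. 1.23 (iii); the
printed «`⟨f⟩_{R_k,δ_k}` is the weighted average of `⟨f⟩_{R,η}` over boundary conditions `η`»).
[cite: Georgii2011, Def. 1.23 (iii)] -/
private theorem integral_integral_eq_of_subset_vec {γ : Specification V S} (hγ : IsSpecification γ)
    {Λ Λ' : Finset V} (h : Λ ⊆ Λ') (η : V → S) {f : (V → S) → E} (hf : Integrable f (γ Λ' η)) :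
    ∫ σ, ∫ τ, f τ ∂(γ Λ σ) ∂(γ Λ' η) = ∫ τ, f τ ∂(γ Λ' η) := by
  let κ : Kernel (V → S) (V → S) := ⟨γ Λ, hγ.measurable_fun Λ⟩
  have hbind : (γ Λ' η).bind (γ Λ) = γ Λ' η := by
    ext A hA
    rw [Measure.bind_apply hA (hγ.measurable_fun Λ).aemeasurable]
    exact hγ.consistent h η A hA
  have hcomp : (κ ∘ₖ Kernel.const Unit (γ Λ' η)) () = γ Λ' η := by
    rw [Kernel.comp_apply, Kernel.const_apply]
    exact hbind
  have hfi : Integrable f ((κ ∘ₖ Kernel.const Unit (γ Λ' η)) ()) := by rwa [hcomp]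
  have key := Kernel.integral_comp hfi
  rw [hcomp, Kernel.const_apply] at key
  exact key.symm

/-- DLR equations for vector-valued observables: `∫ (∫ f dγ_Λ(·|η)) dμ(η) = ∫ f dμ` for a Gibbs
measure `μ` (Georgii 2011, Remark 1.24; the printed «tower property of conditional expectation»).
[cite: Georgii2011, Rem. 1.24] -/
private theorem integral_integral_eq_vec {γ : Specification V S} (hγ : IsSpecification γ)
    {μ : Measure (V → S)} (hμ : IsGibbsMeasure γ μ) (Λ : Finset V) {f : (V → S) → E}
    (hf : Integrable f μ) : ∫ η, ∫ σ, f σ ∂(γ Λ η) ∂μ = ∫ σ, f σ ∂μ := by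
  let κ : Kernel (V → S) (V → S) := ⟨γ Λ, hγ.measurable_fun Λ⟩
  have hcomp : (κ ∘ₖ Kernel.const Unit μ) () = μ := by
    rw [Kernel.comp_apply, Kernel.const_apply]
    exact hμ.bind_eq hγ Λ
  have hfi : Integrable f ((κ ∘ₖ Kernel.const Unit μ) ()) := by rwa [hcomp]
  have key := Kernel.integral_comp hfi
  rw [hcomp, Kernel.const_apply] at key
  exact key.symm

end Consistency

/-! ### The column matrices `col(U; y, n) = ∏_{t<n} π(U_{(y + t e₀, 0)})` -/

section Column

variable {d m : ℕ} [NeZero d] {G : Type*} [Group G] (π : G →* Matrix (Fin m) (Fin m) ℂ)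

/-- The ordered product `π(U_{(y,0)}) π(U_{(y+e₀,0)}) ⋯ π(U_{(y+(n−1)e₀,0)})` of the represented
link variables along the vertical column of `n` edges based at `y` — `π` of the holonomy of the
straight walk `lineWalk 0 n y`; its entries are sums of Chatterjee's «vertical chain variables …
a product of one element from each of the matrices `π(ω_{e₁}),…,π(ω_{e_N})`» (§3, p.1014).
[cite: Chatterjee2021, §3 (vertical chain variables)] -/
def colMat (U : LGConfig d G) : Site d → ℕ → Matrix (Fin m) (Fin m) ℂ
  | _, 0 => 1
  | y, n + 1 => π (U (y, 0)) * colMat U (y + Pi.single 0 1) n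

/-- `col(U; y, 0) = 1`. [cite: Chatterjee2021, §3 (vertical chain variables)] -/
@[simp] theorem colMat_zero (U : LGConfig d G) (y : Site d) : colMat π U y 0 = 1 := rfl

/-- `col(U; y, n+1) = π(U_{(y,0)}) · col(U; y + e₀, n)`. [cite: Chatterjee2021, §3 (vertical chain variables)] -/
theorem colMat_succ (U : LGConfig d G) (y : Site d) (n : ℕ) :
    colMat π U y (n + 1) = π (U (y, 0)) * colMat π U (y + Pi.single 0 1) n := rfl

/-- `col(U; y, n)` is `π` of the holonomy of the straight vertical walk of `n` steps from `y`.
[cite: Chatterjee2021, §3 (vertical chain variables)] -/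
theorem map_walkHolonomy_lineWalk_zero (U : LGConfig d G) :
    ∀ (n : ℕ) (y : Site d), π (walkHolonomy U (lineWalk 0 n y)) = colMat π U y n
  | 0, y => by simp [lineWalk]
  | n + 1, y => by
      rw [lineWalk, walkHolonomy_cons, walkHolonomy_copy, map_mul, dartHolonomy_add_single,
        map_walkHolonomy_lineWalk_zero U n, colMat_succ]

/-- For unitary `π` the column matrices are unitary. [cite: Chatterjee2021, §3 («since π is a unitary representation»)] -/
theorem colMat_mem_unitaryGroup (hπu : ∀ g, π g ∈ Matrix.unitaryGroup (Fin m) ℂ) (U : LGConfig d G) :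
    ∀ (n : ℕ) (y : Site d), colMat π U y n ∈ Matrix.unitaryGroup (Fin m) ℂ
  | 0, y => by rw [colMat_zero]; exact one_mem _
  | n + 1, y => by
      rw [colMat_succ]
      exact mul_mem (hπu _) (colMat_mem_unitaryGroup hπu U n _)

/-- Entries of the column matrices are bounded by `1` (unitarity), the printed «`|f| ≤ 1` since
`π` is a unitary representation». [cite: Chatterjee2021, §3 (Lemma 3.2, proof)] -/
theorem norm_colMat_apply_le_one (hπu : ∀ g, π g ∈ Matrix.unitaryGroup (Fin m) ℂ)
    (U : LGConfig d G) (y : Site d) (n : ℕ) (a b : Fin m) : ‖colMat π U y n a b‖ ≤ 1 :=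
  entry_norm_bound_of_unitary (colMat_mem_unitaryGroup π hπu U n y) a b

/-- The column matrices depend continuously on the configuration (product topology), for a
continuous representation. [cite: Chatterjee2021, §3 («f is a bounded continuous function»)] -/
theorem continuous_colMat [TopologicalSpace G] [IsTopologicalGroup G] (hπ : Continuous π) :
    ∀ (n : ℕ) (y : Site d), Continuous fun U : LGConfig d G => colMat π U y n
  | 0, y => by simp only [colMat_zero]; exact continuous_const
  | n + 1, y => by
      simp only [colMat_succ]
      exact (hπ.comp (continuous_apply _)).matrix_mul (continuous_colMat hπ n _)

/-- The column matrix only sees the links of its column. [cite: Chatterjee2021, §3 (vertical chain variables)] -/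
theorem colMat_congr {U V : LGConfig d G} :
    ∀ (n : ℕ) (y : Site d),
      (∀ t : ℕ, t < n → U (y + Pi.single 0 (t : ℤ), 0) = V (y + Pi.single 0 (t : ℤ), 0)) →
        colMat π U y n = colMat π V y n
  | 0, y, _ => rfl
  | n + 1, y, h => by
      rw [colMat_succ, colMat_succ]
      have h0 := h 0 (Nat.succ_pos n)
      simp only [Nat.cast_zero, Pi.single_zero, add_zero] at h0
      rw [h0, colMat_congr n (y + Pi.single 0 1) fun t ht => ?_]
      have := h (t + 1) (Nat.succ_lt_succ ht)
      rwa [Nat.cast_succ, add_comm (t : ℤ) 1, Pi.single_add, ← add_assoc] at this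

/-- The edges of the column of height `n` based at `y`. [cite: Chatterjee2021, §3 (vertical chain)] -/
def colEdges (y : Site d) (n : ℕ) : Finset (ZdEdge d) :=
  (Finset.range n).image fun t : ℕ => (y + Pi.single 0 (t : ℤ), (0 : Fin d))

/-- Membership in `colEdges`. [cite: Chatterjee2021, §3 (vertical chain)] -/
theorem mem_colEdges {y : Site d} {n : ℕ} {e : ZdEdge d} :
    e ∈ colEdges y n ↔ ∃ t : ℕ, t < n ∧ e = (y + Pi.single 0 (t : ℤ), (0 : Fin d)) := by
  simp only [colEdges, Finset.mem_image, Finset.mem_range, eq_comm (a := e)]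

/-- Each entry of the column matrix is a cylinder observable supported on the column edges.
[cite: Chatterjee2021, §3 (vertical chain variables)] -/
theorem isCylinder_colMat_apply (y : Site d) (n : ℕ) (a b : Fin m) :
    IsCylinder (fun U : LGConfig d G => colMat π U y n a b) (colEdges y n) := by
  intro U V h
  change colMat π U y n a b = colMat π V y n a b
  rw [colMat_congr π n y fun t ht => h _ (Finset.mem_coe.2 (mem_colEdges.2 ⟨t, ht, rfl⟩))]

/-- Columns add: `col(U; y, n₁ + n₂) = col(U; y, n₁) · col(U; y + n₁e₀, n₂)` (the printed
splitting `f = f₁ f₂ ⋯ f_{q+1}` of a vertical chain variable across consecutive slabs).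
[cite: Chatterjee2021, §3 (Lemma 3.2, proof)] -/
theorem colMat_add (U : LGConfig d G) :
    ∀ (n₁ n₂ : ℕ) (y : Site d),
      colMat π U y (n₁ + n₂) = colMat π U y n₁ * colMat π U (y + Pi.single 0 (n₁ : ℤ)) n₂
  | 0, n₂, y => by simp
  | n₁ + 1, n₂, y => by
      rw [Nat.succ_add, colMat_succ, colMat_succ, colMat_add U n₁ n₂, mul_assoc, add_assoc,
        ← Pi.single_add, Nat.cast_succ, add_comm (1 : ℤ)]

/-- **The centre transform multiplies a column through the bottom layer by `c`**: if
`π(g₀) = c·1` then `col(τ_{g₀} U; y, n) = c · col(U; y, n)` for `y` in the layer `0` and `n ≥ 1`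
(the printed «under the center transform … `f` transforms to `cf`»). [cite: Chatterjee2021, §3 (Lemma 3.1, proof)] -/
theorem colMat_centreTransform {g₀ : G} {c : ℂ} (hc : π g₀ = c • (1 : Matrix (Fin m) (Fin m) ℂ))
    (U : LGConfig d G) {y : Site d} (hy : y 0 = 0) (n : ℕ) :
    colMat π (centreTransform g₀ U) y (n + 1) = c • colMat π U y (n + 1) := by
  rw [colMat_succ, colMat_succ, centreTransform_apply_of_pos g₀ U ⟨rfl, hy⟩, map_mul, hc,
    colMat_congr π n (y + Pi.single 0 1) (V := U) fun t _ => ?_]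
  · rw [smul_mul_assoc, one_mul, smul_mul_assoc]
  · refine centreTransform_apply_of_neg g₀ U fun h => ?_
    have h2 := h.2
    simp only [Pi.add_apply, Pi.single_eq_same, hy] at h2
    omega

/-- Columns are translation covariant: `col(θ_v U; y + v, n) = col(U; y, n)`. [cite: Chatterjee2021, §3 (translate of the slab)] -/
theorem colMat_configShift [MeasurableSpace G] (v : Site d) (U : LGConfig d G) :
    ∀ (n : ℕ) (y : Site d), colMat π (configShift v U) (y + v) n = colMat π U y n
  | 0, y => rfl
  | n + 1, y => by
      rw [colMat_succ, colMat_succ, configShift_apply, add_sub_cancel_right, add_right_comm,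
        colMat_configShift v U n]

end Column

/-! ### The finite slabs `S_R`: interior slab edges within lateral distance `R − 1` -/

section SlabBox

variable {d : ℕ} [NeZero d]

/-- The edge set of the finite slab `S_R = {0,…,n} × {−R,…,R}^{d−1}` that is resampled by «the
lattice gauge theory on `S_R` with boundary condition»: the interior slab edges
(`IsSlabInteriorEdge n`) both of whose endpoints have all lateral coordinates in `[−(R−1), R−1]`
(the links on the lateral boundary `|x_k| = R` and on the two faces are boundary links).
[cite: Chatterjee2021, §3 (the slabs S_R)] -/
def slabBox (n R : ℕ) : Finset (ZdEdge d) :=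
  open Classical in
  ((Fintype.piFinset fun _ : Fin d => Finset.Icc (-((n : ℤ) + R)) ((n : ℤ) + R)) ×ˢ
      (Finset.univ : Finset (Fin d))).filter
    fun e => IsSlabInteriorEdge n e ∧ (∀ k : Fin d, k ≠ 0 → |e.1 k| + 1 ≤ (R : ℤ)) ∧
      ∀ k : Fin d, k ≠ 0 → |(e.1 + Pi.single e.2 (1 : ℤ) : Site d) k| + 1 ≤ (R : ℤ)

/-- Membership in `slabBox`. [cite: Chatterjee2021, §3 (the slabs S_R)] -/
theorem mem_slabBox {n R : ℕ} {e : ZdEdge d} :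
    e ∈ slabBox n R ↔ IsSlabInteriorEdge n e ∧ (∀ k : Fin d, k ≠ 0 → |e.1 k| + 1 ≤ (R : ℤ)) ∧
      ∀ k : Fin d, k ≠ 0 → |(e.1 + Pi.single e.2 (1 : ℤ) : Site d) k| + 1 ≤ (R : ℤ) := by
  classical
  rw [slabBox, Finset.mem_filter]
  refine ⟨fun h => h.2, fun h => ⟨?_, h⟩⟩
  refine Finset.mem_product.2 ⟨Fintype.mem_piFinset.2 fun k => Finset.mem_Icc.2 ?_, Finset.mem_univ _⟩
  by_cases hk : k = 0
  · subst hk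
    rcases h.1 with ⟨-, h0, h1⟩ | ⟨-, h0, h1⟩ <;> constructor <;> omega
  · have hk' := h.2.1 k hk
    have habs := abs_le.1 (show |e.1 k| ≤ (n : ℤ) + R by
      have := abs_nonneg (e.1 k); omega)
    exact ⟨habs.1, habs.2⟩

/-- `slabBox n R` consists of interior slab edges. [cite: Chatterjee2021, §3 (the slabs S_R)] -/
theorem isSlabInteriorEdge_of_mem_slabBox {n R : ℕ} {e : ZdEdge d} (h : e ∈ slabBox n R) :
    IsSlabInteriorEdge n e :=
  (mem_slabBox.1 h).1

/-- Every interior slab edge lies in `slabBox n R` for all large `R` (the finite slabs exhaust the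
slab). [cite: Chatterjee2021, §3 (the slabs S_R)] -/
theorem eventually_mem_slabBox {n : ℕ} {e : ZdEdge d} (he : IsSlabInteriorEdge n e) :
    ∃ R₀ : ℕ, ∀ R : ℕ, R₀ ≤ R → e ∈ slabBox n R := by
  refine ⟨(Finset.univ.sup fun k : Fin d => (e.1 k).natAbs) + 2, fun R hR => mem_slabBox.2 ⟨he, ?_, ?_⟩⟩
  · intro k _
    have hk : (e.1 k).natAbs ≤ Finset.univ.sup fun k : Fin d => (e.1 k).natAbs :=
      Finset.le_sup (f := fun k : Fin d => (e.1 k).natAbs) (Finset.mem_univ k)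
    have : |e.1 k| = ((e.1 k).natAbs : ℤ) := (Int.natCast_natAbs _).symm
    omega
  · intro k _
    have hk : (e.1 k).natAbs ≤ Finset.univ.sup fun k : Fin d => (e.1 k).natAbs :=
      Finset.le_sup (f := fun k : Fin d => (e.1 k).natAbs) (Finset.mem_univ k)
    have h1 : |e.1 k| = ((e.1 k).natAbs : ℤ) := (Int.natCast_natAbs _).symm
    have h2 : |(e.1 + Pi.single e.2 (1 : ℤ) : Site d) k| ≤ |e.1 k| + 1 := by
      rw [Pi.add_apply]
      refine (abs_add_le _ _).trans (add_le_add le_rfl ?_)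
      by_cases hke : k = e.2
      · subst hke; simp
      · simp [Pi.single_eq_of_ne hke]
    omega

/-- For every finite edge set, its interior slab edges lie in `slabBox n R` for all large `R`.
[cite: Chatterjee2021, §3 (the slabs S_R)] -/
theorem eventually_filter_subset_slabBox (n : ℕ) (Λ : Finset (ZdEdge d)) :
    ∃ R₀ : ℕ, ∀ R : ℕ, R₀ ≤ R → Λ.filter (IsSlabInteriorEdge n) ⊆ slabBox n R := by
  classical
  have h : ∀ e : ZdEdge d, ∃ R₀ : ℕ, ∀ R : ℕ, R₀ ≤ R → IsSlabInteriorEdge n e → e ∈ slabBox n R := by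
    intro e
    by_cases he : IsSlabInteriorEdge n e
    · obtain ⟨R₀, hR₀⟩ := eventually_mem_slabBox he
      exact ⟨R₀, fun R hR _ => hR₀ R hR⟩
    · exact ⟨0, fun _ _ he' => absurd he' he⟩
  choose R₀ hR₀ using h
  refine ⟨Λ.sup R₀, fun R hR e he => ?_⟩
  rw [Finset.mem_filter] at he
  exact hR₀ e R (le_trans (Finset.le_sup he.1) hR) he.2

/-- The column of height `n` through the origin lies in every finite slab `S_R`, `R ≥ 1`.
[cite: Chatterjee2021, §3 («the unique vertical chain containing the origin»)] -/
theorem colEdges_zero_subset_slabBox {n R : ℕ} (hR : 1 ≤ R) : colEdges (0 : Site d) n ⊆ slabBox n R := by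
  intro e he
  obtain ⟨t, ht, rfl⟩ := mem_colEdges.1 he
  refine mem_slabBox.2 ⟨Or.inl ⟨rfl, ?_, ?_⟩, fun k hk => ?_, fun k hk => ?_⟩
  · simp
  · simp only [zero_add, Pi.single_eq_same]; omega
  · simp only [zero_add, Pi.single_eq_of_ne hk, abs_zero]; exact_mod_cast hR
  · simp only [zero_add, Pi.add_apply, Pi.single_eq_of_ne hk, add_zero, abs_zero]; exact_mod_cast hR

end SlabBox

/-! ### Lemma 3.1: the column kernels are uniformly small in wide slabs -/

section Lemma31

variable {d N m : ℕ} [NeZero d] {G : Type*} [Group G] [TopologicalSpace G] [IsTopologicalGroup G]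
  [CompactSpace G] [T2Space G] [SecondCountableTopology G] [MeasurableSpace G] [BorelSpace G]
  (ρ : G →* Matrix (Fin N) (Fin N) ℂ) (π : G →* Matrix (Fin m) (Fin m) ℂ)

omit [NeZero d] in
/-- The DLR equation for a set `A` follows from the DLR identity on bounded continuous
observables (bounded continuous functions separate finite Borel measures on the compact
metrisable configuration space) — the mechanism of the printed «the limit law is easily verified
to be a Gibbs measure» (Georgii 2011, Thm. 4.17). [cite: Georgii2011, Thm. 4.17] -/
private theorem dlr_of_forall_continuous (hρ : Continuous ρ) (β : ℝ) (Λ : Finset (ZdEdge d))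
    {μ : Measure (LGConfig d G)} [IsProbabilityMeasure μ]
    (core : ∀ F : LGConfig d G → ℝ, Continuous F → ∀ C : ℝ, (∀ U, |F U| ≤ C) →
      ∫ U, F U ∂μ = ∫ η, (∫ U, F U ∂(ymSpecification ρ β Λ η)) ∂μ)
    {A : Set (LGConfig d G)} (hA : MeasurableSet A) :
    ∫⁻ η, ymSpecification ρ β Λ η A ∂μ = μ A := by
  have hκ : Measurable (ymSpecification ρ β Λ) :=
    Measure.measurable_of_measurable_coe _ fun s hs =>
      measurable_ymSpecification_apply ρ hρ β Λ hs
  have hμeq : μ = μ.bind (ymSpecification ρ β Λ) := by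
    refine ext_of_forall_lintegral_eq_of_IsFiniteMeasure fun f => ?_
    have hfm : Measurable fun x => (f x : ENNReal) :=
      measurable_coe_nnreal_ennreal.comp f.continuous.measurable
    rw [Measure.lintegral_bind hκ.aemeasurable hfm.aemeasurable]
    have hfc : Continuous fun x => (f x : ℝ) := NNReal.continuous_coe.comp f.continuous
    have hfb : ∀ x, |(f x : ℝ)| ≤ nndist f 0 := fun x => by
      rw [abs_of_nonneg (f x).coe_nonneg]
      exact_mod_cast BoundedContinuousFunction.NNReal.upper_bound f x
    have hint : ∀ (m : Measure (LGConfig d G)) [IsFiniteMeasure m],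
        ∫⁻ x, (f x : ENNReal) ∂m = ENNReal.ofReal (∫ x, (f x : ℝ) ∂m) := by
      intro m _
      rw [← BoundedContinuousFunction.toReal_lintegral_coe_eq_integral,
        ENNReal.ofReal_toReal (BoundedContinuousFunction.lintegral_lt_top_of_nnreal m f).ne]
    have hpt : (fun η => ∫⁻ x, (f x : ENNReal) ∂(ymSpecification ρ β Λ η)) = fun η =>
        ENNReal.ofReal (∫ x, (f x : ℝ) ∂(ymSpecification ρ β Λ η)) :=
      funext fun η => by
        haveI := isProbabilityMeasure_ymSpecification ρ hρ β Λ η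
        exact hint _
    rw [hint μ, hpt, ← ofReal_integral_eq_lintegral_ofReal]
    · rw [core _ hfc _ hfb]
    · exact integrable_of_bound (continuous_integral_ymSpecification ρ hρ β Λ hfc
        hfb).aestronglyMeasurable (abs_integral_ymSpecification_le ρ hρ β Λ hfb)
    · exact ae_of_all _ fun η => integral_nonneg fun x => (f x).coe_nonneg
  calc ∫⁻ η, ymSpecification ρ β Λ η A ∂μ = (μ.bind (ymSpecification ρ β Λ)) A :=
        (Measure.bind_apply hA hκ.aemeasurable).symm
    _ = μ A := by rw [← hμeq]

/-- **Chatterjee 2021, Lemma 3.1** (matrix form): if every Gibbs measure of the slab theory of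
height `n ≥ 1` is invariant under the centre transforms («unbroken center symmetry under any
boundary condition»), `g₀ ∈ Z(G)` and `π(g₀) = c·1` with `c ≠ 1`, then the kernel expectations of
the entries of the column `col(·; 0, n)` through the origin in the finite slabs `S_R` tend to `0`
as `R → ∞`, UNIFORMLY in the boundary condition: «`lim_{R→∞} sup_{f,δ} |⟨f⟩_{R,δ}| = 0`». Proof as
printed: otherwise there are `ε > 0`, `R_k → ∞` and boundary conditions `η_k` with
`|⟨f⟩_{R_k,η_k}| ≥ ε`; by compactness (Prokhorov on the compact metrisable `G^{edges}`, and of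
`G^{edges}` itself for the boundary conditions) a subsequence of the finite-slab laws converges
weakly to `ν` and `η_k → δ`; `ν` satisfies the DLR equations of the slab specification
(consistency of the kernels for `k` large, Feller continuity, and bounded continuous functions
determine the measure) and is concentrated on `{U = δ off the interior edges}` (properness and
`η_k → δ` coordinatewise), so `ν ∈ slabGibbsMeasures ρ β n δ`; then `τ_{g₀} ν = ν` while
`f ∘ τ_{g₀} = c f`, whence `⟨f⟩_ν = c⟨f⟩_ν`, `⟨f⟩_ν = 0`, contradicting `|⟨f⟩_ν| ≥ ε`.
[cite: Chatterjee2021, Lemma 3.1] -/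
theorem colKernel_tendsto_zero (hρ : Continuous ρ) (hπ : Continuous π)
    (hπu : ∀ g, π g ∈ Matrix.unitaryGroup (Fin m) ℂ) {β : ℝ} {n : ℕ} (hn : 1 ≤ n)
    (hCU : ∀ δ : LGConfig d G, SlabCentreUnbroken ρ β n δ) {g₀ : G}
    (hg₀ : g₀ ∈ Subgroup.center G) {c : ℂ} (hc : π g₀ = c • (1 : Matrix (Fin m) (Fin m) ℂ))
    (hc1 : c ≠ 1) :
    ∀ ε > 0, ∃ R₀ : ℕ, ∀ R : ℕ, R₀ ≤ R → ∀ (η : LGConfig d G) (a b : Fin m),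
      ‖∫ U, colMat π U 0 n a b ∂(ymSpecification ρ β (slabBox n R) η)‖ ≤ ε := by
  intro ε hε
  obtain ⟨n', rfl⟩ : ∃ n', n = n' + 1 := ⟨n - 1, by omega⟩
  have hγ := QuantumFieldTheory.isSpecification_ymSpecification_of_t2Space (d := d) ρ hρ β
  -- it suffices to treat one entry `(a, b)` at a time
  suffices key : ∀ a b : Fin m, ∃ R₀ : ℕ, ∀ R : ℕ, R₀ ≤ R → ∀ η : LGConfig d G,
      ‖∫ U, colMat π U 0 (n' + 1) a b ∂(ymSpecification ρ β (slabBox (n' + 1) R) η)‖ ≤ ε by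
    choose R₀ hR₀ using key
    refine ⟨Finset.univ.sup fun p : Fin m × Fin m => R₀ p.1 p.2, fun R hR η a b =>
      hR₀ a b R (le_trans ?_ hR) η⟩
    exact Finset.le_sup (f := fun p : Fin m × Fin m => R₀ p.1 p.2) (Finset.mem_univ (a, b))
  intro a b
  -- the observable
  set f : LGConfig d G → ℂ := fun U => colMat π U 0 (n' + 1) a b with hf_def
  have hf_cont : Continuous f := by
    simp only [hf_def]
    exact (continuous_apply b).comp ((continuous_apply a).comp (continuous_colMat π hπ (n' + 1) 0))
  have hf_bd : ∀ U, ‖f U‖ ≤ 1 := fun U => norm_colMat_apply_le_one π hπu U 0 (n' + 1) a b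
  have hf_tau : ∀ U, f (centreTransform g₀ U) = c * f U := fun U => by
    simp only [hf_def]
    rw [colMat_centreTransform π hc U (show (0 : Site d) 0 = 0 from rfl) n', Matrix.smul_apply,
      smul_eq_mul]
  by_contra H
  push Not at H
  choose R hR η hbig using H
  -- the finite-slab laws as probability measures
  have hprob : ∀ (Λ : Finset (ZdEdge d)) (ζ : LGConfig d G),
      IsProbabilityMeasure (ymSpecification ρ β Λ ζ) := isProbabilityMeasure_ymSpecification ρ hρ β
  let ν : ℕ → ProbabilityMeasure (LGConfig d G) := fun k =>
    ⟨ymSpecification ρ β (slabBox (n' + 1) (R k)) (η k), hprob _ _⟩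
  have hνcoe : ∀ k, ((ν k : ProbabilityMeasure (LGConfig d G)) : Measure (LGConfig d G)) =
      ymSpecification ρ β (slabBox (n' + 1) (R k)) (η k) := fun k => rfl
  -- compactness: a weakly convergent subsequence with convergent boundary conditions
  obtain ⟨⟨νl, δ⟩, -, φ, hφ, hlim⟩ :=
    (isCompact_univ (X := ProbabilityMeasure (LGConfig d G) × LGConfig d G)).tendsto_subseq
      (x := fun k => (ν k, η k)) fun _ => Set.mem_univ _
  have hν : Tendsto (fun k => ν (φ k)) atTop (𝓝 νl) := (continuous_fst.tendsto _).comp hlim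
  have hη : Tendsto (fun k => η (φ k)) atTop (𝓝 δ) := (continuous_snd.tendsto _).comp hlim
  have hW : ∀ g : BoundedContinuousFunction (LGConfig d G) ℝ,
      Tendsto (fun k => ∫ U, g U ∂(ν (φ k) : Measure (LGConfig d G))) atTop
        (𝓝 (∫ U, g U ∂(νl : Measure (LGConfig d G)))) :=
    fun g => (ProbabilityMeasure.tendsto_iff_forall_integral_tendsto.1 hν) g
  -- bounded continuous real observables as `BoundedContinuousFunction`s
  have hWr : ∀ (g : LGConfig d G → ℝ), Continuous g → ∀ C : ℝ, (∀ U, |g U| ≤ C) →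
      Tendsto (fun k => ∫ U, g U ∂(ν (φ k) : Measure (LGConfig d G))) atTop
        (𝓝 (∫ U, g U ∂(νl : Measure (LGConfig d G)))) := by
    intro g hg C hC
    exact hW (BoundedContinuousFunction.ofNormedAddCommGroup g hg C fun U => by
      simpa [Real.norm_eq_abs] using hC U)
  -- (i) the limit expectation of `f` has norm `≥ ε`
  have htend : Tendsto (fun k => ∫ U, f U ∂(ν (φ k) : Measure (LGConfig d G))) atTop
      (𝓝 (∫ U, f U ∂(νl : Measure (LGConfig d G)))) :=
    (ProbabilityMeasure.tendsto_iff_forall_integral_rclike_tendsto ℂ).1 hν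
      (BoundedContinuousFunction.ofNormedAddCommGroup f hf_cont 1 hf_bd)
  have hnorm : ε ≤ ‖∫ U, f U ∂(νl : Measure (LGConfig d G))‖ := by
    refine ge_of_tendsto ((continuous_norm.tendsto _).comp htend) (Eventually.of_forall fun k => ?_)
    have := hbig (φ k)
    rw [← hνcoe (φ k)] at this
    exact this.le
  -- (ii-a) the limit law satisfies the DLR equations of the slab specification
  have hDLR : IsGibbsMeasure (slabSpecification ρ β (n' + 1)) (νl : Measure (LGConfig d G)) := by
    refine ⟨inferInstance, fun Λ A hA => ?_⟩
    change ∫⁻ ζ, ymSpecification ρ β (Λ.filter (IsSlabInteriorEdge (n' + 1))) ζ A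
      ∂(νl : Measure (LGConfig d G)) = _
    set Λ' := Λ.filter (IsSlabInteriorEdge (d := d) (n' + 1))
    obtain ⟨K, hK⟩ := eventually_filter_subset_slabBox (d := d) (n' + 1) Λ
    refine dlr_of_forall_continuous ρ hρ β Λ' (fun F hF C hC => ?_) hA
    -- `∫ F dν_k = ∫ (γ_{Λ'} F) dν_k` for `k ≥ K` by consistency, then pass to the limit
    have hκF_cont : Continuous fun ζ => ∫ U, F U ∂(ymSpecification ρ β Λ' ζ) :=
      continuous_integral_ymSpecification ρ hρ β Λ' hF hC
    have hκF_bd : ∀ ζ, |∫ U, F U ∂(ymSpecification ρ β Λ' ζ)| ≤ C :=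
      abs_integral_ymSpecification_le ρ hρ β Λ' hC
    have h1 := hWr F hF C hC
    have h2 := hWr _ hκF_cont C hκF_bd
    refine tendsto_nhds_unique_of_eventuallyEq h1 h2 ?_
    filter_upwards [eventually_ge_atTop K] with k hk
    have hsub : Λ' ⊆ slabBox (n' + 1) (R (φ k)) :=
      hK _ (le_trans hk (le_trans (hφ.id_le k) (hR (φ k))))
    rw [hνcoe]
    exact (integral_integral_eq_of_subset_vec hγ hsub (η (φ k))
      (integrable_of_bound hF.aestronglyMeasurable hC)).symm
  -- (ii-b) the limit law is concentrated on `{U = δ off the interior edges}`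
  have hconc : ∀ᵐ U ∂(νl : Measure (LGConfig d G)), ∀ e : ZdEdge d,
      ¬ IsSlabInteriorEdge (n' + 1) e → U e = δ e := by
    letI : MetricSpace G := TopologicalSpace.metrizableSpaceMetric G
    rw [ae_all_iff]
    intro e
    by_cases he : IsSlabInteriorEdge (n' + 1) e
    · exact ae_of_all _ fun U h => absurd he h
    -- the test function `ψ(U) = min(dist(U_e, δ_e), 1)`
    set ψ : LGConfig d G → ℝ := fun U => min (dist (U e) (δ e)) 1 with hψ_def
    have hψ_cont : Continuous ψ :=
      (((continuous_apply e).dist continuous_const).min continuous_const)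
    have hψ_nn : ∀ U, 0 ≤ ψ U := fun U => le_min dist_nonneg zero_le_one
    have hψ_bd : ∀ U, |ψ U| ≤ 1 := fun U => by
      rw [abs_of_nonneg (hψ_nn U)]; exact min_le_right _ _
    -- under the `k`-th finite-slab law, `U_e = η_k e` almost surely (properness)
    have hval : ∀ k, ∫ U, ψ U ∂(ν (φ k) : Measure (LGConfig d G)) =
        min (dist (η (φ k) e) (δ e)) 1 := by
      intro k
      have hnot : e ∉ slabBox (d := d) (n' + 1) (R (φ k)) := fun h =>
        he (isSlabInteriorEdge_of_mem_slabBox h)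
      have hae : ∀ᵐ U ∂(ν (φ k) : Measure (LGConfig d G)), ψ U =
          min (dist (η (φ k) e) (δ e)) 1 := by
        rw [hνcoe]
        filter_upwards [hγ.proper (slabBox (n' + 1) (R (φ k))) (η (φ k))] with U hU
        simp only [hψ_def, hU e hnot]
      rw [integral_congr_ae hae]
      simp
    have hlim0 : Tendsto (fun k => ∫ U, ψ U ∂(ν (φ k) : Measure (LGConfig d G))) atTop (𝓝 0) := by
      simp_rw [hval]
      have h1 : Tendsto (fun k => η (φ k) e) atTop (𝓝 (δ e)) := (continuous_apply e).tendsto _ |>.comp hη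
      have h2 := (h1.dist (tendsto_const_nhds (x := δ e))).min (tendsto_const_nhds (x := (1 : ℝ)))
      simpa [dist_self] using h2
    have hint0 : ∫ U, ψ U ∂(νl : Measure (LGConfig d G)) = 0 :=
      tendsto_nhds_unique (hWr ψ hψ_cont 1 hψ_bd) hlim0
    have hψ0 : ψ =ᵐ[(νl : Measure (LGConfig d G))] 0 :=
      (integral_eq_zero_iff_of_nonneg hψ_nn
        (integrable_of_bound hψ_cont.aestronglyMeasurable hψ_bd)).1 hint0
    filter_upwards [hψ0] with U hU _
    have hU' : min (dist (U e) (δ e)) 1 = 0 := hU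
    rcases min_choice (dist (U e) (δ e)) 1 with h | h
    · rw [h] at hU'; exact dist_eq_zero.1 hU'
    · rw [h] at hU'; exact absurd hU' one_ne_zero
  have hmem : (νl : Measure (LGConfig d G)) ∈ slabGibbsMeasures ρ β (n' + 1) δ := ⟨hDLR, hconc⟩
  -- (iii) centre symmetry forces the limit expectation of `f` to vanish
  have hinv := hCU δ g₀ hg₀ _ hmem
  have hI : ∫ U, f U ∂(νl : Measure (LGConfig d G)) = c * ∫ U, f U ∂(νl : Measure (LGConfig d G)) := by
    conv_lhs => rw [← hinv]
    rw [integral_map (measurable_centreTransform g₀).aemeasurable hf_cont.aestronglyMeasurable]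
    simp_rw [hf_tau]
    exact integral_const_mul _ _
  have hzero : ∫ U, f U ∂(νl : Measure (LGConfig d G)) = 0 := by
    have h1 : (1 - c) * ∫ U, f U ∂(νl : Measure (LGConfig d G)) = 0 := by
      rw [sub_mul, one_mul, ← hI, sub_self]
    exact (mul_eq_zero.1 h1).resolve_left (sub_ne_zero.2 hc1.symm)
  rw [hzero, norm_zero] at hnorm
  exact absurd hnorm (not_le.2 hε)

end Lemma31

/-! ### Lemma 3.2 (bootstrap): kernels of products of column blocks factorise -/

section FactorisationHelpers

variable {d m : ℕ} {G : Type*}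

/-- Gluing boundary conditions that agree on `T` off `Λ` gives configurations agreeing on `T`. [folklore] -/
private theorem glueWith_congr_off {Λ T : Finset (ZdEdge d)} {η η' : LGConfig d G}
    (h : ∀ e ∈ T, e ∉ Λ → η e = η' e) (ζ : ↥Λ → G) {e : ZdEdge d} (he : e ∈ T) :
    glueWith Λ ζ η e = glueWith Λ ζ η' e := by
  by_cases heΛ : e ∈ Λ
  · simp [glueWith_apply_mem _ _ _ heΛ]
  · simp [glueWith_apply_not_mem _ _ _ heΛ, h e he heΛ]

/-- Properness: a matrix-valued cylinder factor supported off `Λ` is a.s. frozen under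
`γ_Λ(· | η)` and factors out on the right, `∫ F·W dγ_Λ(η) = (∫ F dγ_Λ(η))·W(η)` (Georgii 2011,
(1.16)–(1.18) and Remark 1.20; the printed «`f₂` depends only on `ω_e` for edges `e` that are on
the boundary of `S`»). [cite: Georgii2011, (1.16)–(1.18), Remark 1.20] -/
private theorem matrixIntegral_mul_of_ae_eq [MeasurableSpace G] (ν : Measure (LGConfig d G))
    {F W : LGConfig d G → Matrix (Fin m) (Fin m) ℂ} (hF : ∀ a b, Integrable (fun U => F U a b) ν)
    {η : LGConfig d G} (hW : ∀ᵐ U ∂ν, W U = W η) :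
    matrixIntegral ν (fun U => F U * W U) = matrixIntegral ν F * W η := by
  rw [← matrixIntegral_mul_const ν hF (W η)]
  ext a b
  simp only [matrixIntegral_apply]
  refine integral_congr_ae ?_
  filter_upwards [hW] with U hU
  rw [hU]

/-- Properness, left version: `∫ W·F dγ_Λ(η) = W(η)·∫ F dγ_Λ(η)`. [cite: Georgii2011, (1.16)–(1.18), Remark 1.20] -/
private theorem matrixIntegral_const_mul_of_ae_eq [MeasurableSpace G] (ν : Measure (LGConfig d G))
    {F W : LGConfig d G → Matrix (Fin m) (Fin m) ℂ} (hF : ∀ a b, Integrable (fun U => F U a b) ν)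
    {η : LGConfig d G} (hW : ∀ᵐ U ∂ν, W U = W η) :
    matrixIntegral ν (fun U => W U * F U) = W η * matrixIntegral ν F := by
  rw [← matrixIntegral_const_mul ν hF (W η)]
  ext a b
  simp only [matrixIntegral_apply]
  refine integral_congr_ae ?_
  filter_upwards [hW] with U hU
  rw [hU]

/-- Continuity of a finite ordered product of continuous matrix-valued observables. [folklore] -/
private theorem continuous_list_prod [TopologicalSpace G] :
    ∀ (L : List (Finset (ZdEdge d) × (LGConfig d G → Matrix (Fin m) (Fin m) ℂ))),
      (∀ bk ∈ L, Continuous bk.2) → Continuous fun U : LGConfig d G => (L.map fun bk => bk.2 U).prod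
  | [], _ => by simpa using continuous_const
  | bk :: L, h => by
      simp only [List.map_cons, List.prod_cons]
      exact (h bk List.mem_cons_self).matrix_mul
        (continuous_list_prod L fun bk' hbk' => h bk' (List.mem_cons_of_mem _ hbk'))

/-- An ordered product of block observables only sees the links in the blocks. [folklore] -/
private theorem list_prod_congr
    (L : List (Finset (ZdEdge d) × (LGConfig d G → Matrix (Fin m) (Fin m) ℂ)))
    (hsupp : ∀ bk ∈ L, ∀ a b, IsCylinder (fun U => bk.2 U a b) bk.1) {U V : LGConfig d G}
    (h : ∀ bk ∈ L, ∀ e ∈ bk.1, U e = V e) :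
    (L.map fun bk => bk.2 U).prod = (L.map fun bk => bk.2 V).prod := by
  congr 1
  refine List.map_congr_left fun bk hbk => ?_
  ext a b
  exact hsupp bk hbk a b fun e he => h bk hbk e (Finset.mem_coe.1 he)

/-- A bounded continuous complex observable is integrable against a probability measure. [folklore] -/
private theorem integrable_of_norm_le [MeasurableSpace G] [TopologicalSpace G]
    [SecondCountableTopology G] [BorelSpace G] {ν : Measure (LGConfig d G)} [IsProbabilityMeasure ν]
    {f : LGConfig d G → ℂ} (hf : Continuous f) {C : ℝ} (hC : ∀ U, ‖f U‖ ≤ C) : Integrable f ν :=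
  (integrable_const C).mono' hf.aestronglyMeasurable (ae_of_all _ hC)

end FactorisationHelpers

section Factorisation

variable {d N m : ℕ} {G : Type*} [Group G] [TopologicalSpace G] [IsTopologicalGroup G]
  [CompactSpace G] [T2Space G] [SecondCountableTopology G] [MeasurableSpace G] [BorelSpace G]
  (ρ : G →* Matrix (Fin N) (Fin N) ℂ)

omit [T2Space G] in
/-- **Finite range**: the kernel average `γ_Λ(F | ζ)` of a cylinder observable `F` (support `S₀`)
only depends on the boundary condition `ζ` on `(S₀ ∪ collar Λ) ∖ Λ` (Georgii 2011, (2.15);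
Friedli–Velenik 2017, Lemma 6.28 — the printed «conditional expectation given `ω_e` for all `e`
… on the boundary of `S`»). [cite: Georgii2011, (2.15)] -/
theorem integral_ymSpecification_congr_off (hρ : Continuous ρ) (β : ℝ) (Λ : Finset (ZdEdge d))
    {F : LGConfig d G → ℂ} (hFm : Measurable F) {S₀ : Finset (ZdEdge d)} (hFS : IsCylinder F S₀)
    {ζ ζ' : LGConfig d G}
    (h : ∀ e ∈ S₀ ∪ (plaquettesTouching Λ).biUnion plaquetteEdges, e ∉ Λ → ζ e = ζ' e) :
    ∫ U, F U ∂(ymSpecification ρ β Λ ζ) = ∫ U, F U ∂(ymSpecification ρ β Λ ζ') := by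
  have hg : ∀ η : LGConfig d G, Measurable (glueWith Λ · η) := fun η => measurable_glueWith Λ η
  have hw : Continuous fun U : LGConfig d G => Real.exp (-β * wilsonBoundaryAction ρ Λ U) :=
    Real.continuous_exp.comp (continuous_const.mul (continuous_wilsonBoundaryAction ρ hρ Λ))
  have hS := isCylinder_wilsonBoundaryAction_holds (G := G) ρ Λ
  have hF' : ∀ τ : ↥Λ → G, F (glueWith Λ τ ζ) = F (glueWith Λ τ ζ') := fun τ =>
    hFS fun e he => glueWith_congr_off (fun e he hΛ => h e (Finset.mem_union_left _ he) hΛ) τ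
      (Finset.mem_coe.1 he)
  have hS' : ∀ τ : ↥Λ → G, wilsonBoundaryAction ρ Λ (glueWith Λ τ ζ) =
      wilsonBoundaryAction ρ Λ (glueWith Λ τ ζ') := fun τ =>
    hS fun e he => glueWith_congr_off (fun e he hΛ => h e (Finset.mem_union_right _ he) hΛ) τ
      (Finset.mem_coe.1 he)
  unfold ymSpecification
  rw [integral_tilted, integral_tilted, integral_map (hg ζ).aemeasurable, integral_map (hg ζ').aemeasurable,
    integral_map (hg ζ).aemeasurable hw.aestronglyMeasurable,
    integral_map (hg ζ').aemeasurable hw.aestronglyMeasurable]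
  · simp only [hF', hS']
  · exact ((hw.measurable.div_const _).smul hFm).aestronglyMeasurable
  · exact ((hw.measurable.div_const _).smul hFm).aestronglyMeasurable

/-- **Chatterjee 2021, Lemma 3.2 (the bootstrap), kernel form.** Let `Λ` be resampled by the
Wilson kernel `γ_Λ(· | η)` and let `(Λ_k, B_k)_k` be finitely many blocks with `Λ_k ⊆ Λ`
pairwise disjoint, `B_k` a bounded continuous matrix observable supported in `Λ_k`, and such that
every edge of a plaquette touching `Λ_k` that is resampled at all lies in `Λ_k` itself (the blocks
are separated by frozen layers — the printed «conditioning on `ω_e` for all `e ∈ ∪ F_i`, the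
lattice gauge theory on the slab splits up into independent lattice gauge theories in the slabs
`S_1,…,S_{q+1}`»). Then the kernel expectation of the ordered product factorises:
`γ_Λ(∏_k B_k | η) = ∏_k γ_{Λ_k}(B_k | η)` — «`⟨f⟩ = ⟨⟨f₁⟩'⟨f₂⟩'⋯⟨f_{q+1}⟩'⟩`». Proof: consistency
`γ_Λ = γ_Λ γ_{Λ₀}`, properness (the other blocks are frozen under `γ_{Λ₀}`), finite range
(`γ_{Λ₀}(B₀ | ζ)` only depends on `ζ` on frozen links), induction on the number of blocks.
[cite: Chatterjee2021, Lemma 3.2] -/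
theorem matrixIntegral_prod_eq_prod (hρ : Continuous ρ) (β : ℝ) (Λ : Finset (ZdEdge d)) :
    ∀ (L : List (Finset (ZdEdge d) × (LGConfig d G → Matrix (Fin m) (Fin m) ℂ))),
      (∀ bk ∈ L, bk.1 ⊆ Λ) →
      L.Pairwise (fun bk bk' => Disjoint bk.1 bk'.1) →
      (∀ bk ∈ L, ∀ e ∈ (plaquettesTouching bk.1).biUnion plaquetteEdges, e ∈ Λ → e ∈ bk.1) →
      (∀ bk ∈ L, Continuous bk.2) →
      (∀ bk ∈ L, ∀ U a b, ‖bk.2 U a b‖ ≤ 1) →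
      (∀ bk ∈ L, ∀ a b, IsCylinder (fun U => bk.2 U a b) bk.1) →
      ∀ η : LGConfig d G,
        matrixIntegral (ymSpecification ρ β Λ η) (fun U => (L.map fun bk => bk.2 U).prod) =
          (L.map fun bk => matrixIntegral (ymSpecification ρ β bk.1 η) bk.2).prod
  | [], _, _, _, _, _, _, η => by
      haveI := isProbabilityMeasure_ymSpecification ρ hρ β Λ η
      ext a b
      simp [matrixIntegral_apply, integral_const]
  | bk :: L, hsub, hdisj, hcol, hcont, hbd, hsupp, η => by
      have hγ := QuantumFieldTheory.isSpecification_ymSpecification_of_t2Space (d := d) ρ hρ β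
      haveI : ∀ (Λ' : Finset (ZdEdge d)) (ζ : LGConfig d G),
          IsProbabilityMeasure (ymSpecification ρ β Λ' ζ) := isProbabilityMeasure_ymSpecification ρ hρ β
      rw [List.pairwise_cons] at hdisj
      -- names
      set Λ₀ := bk.1 with hΛ₀
      set B₀ := bk.2 with hB₀
      set P : LGConfig d G → Matrix (Fin m) (Fin m) ℂ := fun U => (L.map fun bk' => bk'.2 U).prod
        with hP_def
      set M₀ : LGConfig d G → Matrix (Fin m) (Fin m) ℂ := fun ζ =>
        matrixIntegral (ymSpecification ρ β Λ₀ ζ) B₀ with hM₀_def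
      have hB₀c : Continuous B₀ := hcont bk List.mem_cons_self
      have hPc : Continuous P := continuous_list_prod L fun bk' h' => hcont bk' (List.mem_cons_of_mem _ h')
      have hB₀bd : ∀ U a b, ‖B₀ U a b‖ ≤ 1 := hbd bk List.mem_cons_self
      have hPbd : ∀ U a b, ‖P U a b‖ ≤ (m : ℝ) ^ L.length * 1 ^ L.length := fun U => by
        have h := norm_list_prod_apply_le (m := m) zero_le_one (L.map fun bk' => bk'.2 U)
          (fun X hX => by
            obtain ⟨bk', hbk', rfl⟩ := List.mem_map.1 hX
            exact hbd bk' (List.mem_cons_of_mem _ hbk') U)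
        simpa only [List.length_map] using h
      have hprod_c : Continuous fun U => B₀ U * P U := hB₀c.matrix_mul hPc
      have hprod_bd : ∀ U a b, ‖(B₀ U * P U) a b‖ ≤ m * (1 * ((m : ℝ) ^ L.length * 1 ^ L.length)) :=
        fun U => norm_mul_apply_le (hB₀bd U) (hPbd U)
      have hent : ∀ {F : LGConfig d G → Matrix (Fin m) (Fin m) ℂ}, Continuous F →
          ∀ a b, Continuous fun U => F U a b := fun hF a b =>
        (continuous_apply b).comp ((continuous_apply a).comp hF)
      -- step 1: consistency `γ_Λ = γ_Λ γ_{Λ₀}`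
      have h1 : matrixIntegral (ymSpecification ρ β Λ η) (fun U => B₀ U * P U) =
          matrixIntegral (ymSpecification ρ β Λ η) fun ζ =>
            matrixIntegral (ymSpecification ρ β Λ₀ ζ) fun U => B₀ U * P U := by
        ext a b
        simp only [matrixIntegral_apply]
        exact (integral_integral_eq_of_subset_vec hγ (hsub bk List.mem_cons_self) η
          (integrable_of_norm_le ((hent hprod_c) a b) fun U => hprod_bd U a b)).symm
      -- step 2: under `γ_{Λ₀}(ζ)` the other blocks are frozen: `P U = P ζ` a.s.
      have h2 : ∀ ζ, matrixIntegral (ymSpecification ρ β Λ₀ ζ) (fun U => B₀ U * P U) = M₀ ζ * P ζ := by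
        intro ζ
        refine matrixIntegral_mul_of_ae_eq _ (fun a b => integrable_of_norm_le ((hent hB₀c) a b)
          fun U => hB₀bd U a b) ?_
        filter_upwards [hγ.proper Λ₀ ζ] with U hU
        refine list_prod_congr L (fun bk' h' => hsupp bk' (List.mem_cons_of_mem _ h')) fun bk' hbk' e he => ?_
        exact hU e (Finset.disjoint_right.1 (hdisj.1 bk' hbk') he)
      -- step 3: `M₀ ζ = M₀ η` for `γ_Λ(η)`-a.e. `ζ` (finite range + frozen layers)
      have h3 : ∀ᵐ ζ ∂(ymSpecification ρ β Λ η), M₀ ζ = M₀ η := by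
        filter_upwards [hγ.proper Λ η] with ζ hζ
        ext a b
        simp only [hM₀_def, matrixIntegral_apply]
        refine integral_ymSpecification_congr_off ρ hρ β Λ₀ ((hent hB₀c) a b).measurable
          (hsupp bk List.mem_cons_self a b) fun e he heΛ₀ => ?_
        refine hζ e fun heΛ => heΛ₀ ?_
        rcases Finset.mem_union.1 he with he | he
        · exact he
        · exact hcol bk List.mem_cons_self e he heΛ
      -- step 4: assemble with the induction hypothesis
      have hM₀P_int : ∀ a b, Integrable (fun ζ => (M₀ ζ * P ζ) a b) (ymSpecification ρ β Λ η) := by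
        intro a b
        have heq : (fun ζ => (M₀ ζ * P ζ) a b) = fun ζ =>
            (matrixIntegral (ymSpecification ρ β Λ₀ ζ) fun U => B₀ U * P U) a b :=
          funext fun ζ => by rw [h2 ζ]
        rw [heq]
        simp only [matrixIntegral_apply]
        refine integrable_of_norm_le ?_ (C := m * (1 * ((m : ℝ) ^ L.length * 1 ^ L.length))) fun ζ => ?_
        · -- continuity in the boundary condition (Feller), via real and imaginary parts
          have hre : Continuous fun ζ => ∫ U, ((B₀ U * P U) a b).re ∂(ymSpecification ρ β Λ₀ ζ) :=
            continuous_integral_ymSpecification ρ hρ β Λ₀ (Complex.continuous_re.comp ((hent hprod_c) a b))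
              fun U => (Complex.abs_re_le_norm _).trans (hprod_bd U a b)
          have him : Continuous fun ζ => ∫ U, ((B₀ U * P U) a b).im ∂(ymSpecification ρ β Λ₀ ζ) :=
            continuous_integral_ymSpecification ρ hρ β Λ₀ (Complex.continuous_im.comp ((hent hprod_c) a b))
              fun U => (Complex.abs_im_le_norm _).trans (hprod_bd U a b)
          have hdec : (fun ζ => ∫ U, (B₀ U * P U) a b ∂(ymSpecification ρ β Λ₀ ζ)) = fun ζ =>
              ((∫ U, ((B₀ U * P U) a b).re ∂(ymSpecification ρ β Λ₀ ζ) : ℝ) : ℂ) +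
                ((∫ U, ((B₀ U * P U) a b).im ∂(ymSpecification ρ β Λ₀ ζ) : ℝ) : ℂ) * Complex.I := by
            funext ζ
            have h := integral_re_add_im (integrable_of_norm_le (ν := ymSpecification ρ β Λ₀ ζ)
              ((hent hprod_c) a b) fun U => hprod_bd U a b)
            rw [← h]
            simp only [RCLike.re_to_complex, RCLike.im_to_complex, RCLike.I_to_complex]
            rfl
          rw [hdec]
          exact ((Complex.continuous_ofReal.comp hre).add
            ((Complex.continuous_ofReal.comp him).mul continuous_const))
        · have := norm_matrixIntegral_apply_le (ymSpecification ρ β Λ₀ ζ) (fun U => hprod_bd U) a b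
          simpa only [matrixIntegral_apply] using this
      calc matrixIntegral (ymSpecification ρ β Λ η) (fun U => ((bk :: L).map fun bk' => bk'.2 U).prod)
          = matrixIntegral (ymSpecification ρ β Λ η) (fun U => B₀ U * P U) := by
            simp only [List.map_cons, List.prod_cons, hB₀, hP_def]
        _ = matrixIntegral (ymSpecification ρ β Λ η) fun ζ => M₀ ζ * P ζ := by
            rw [h1]; congr 1; funext ζ; exact h2 ζ
        _ = M₀ η * matrixIntegral (ymSpecification ρ β Λ η) P := by
            have hPint : ∀ a b, Integrable (fun ζ => P ζ a b) (ymSpecification ρ β Λ η) := fun a b =>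
              integrable_of_norm_le ((hent hPc) a b) fun U => hPbd U a b
            rw [← matrixIntegral_const_mul _ hPint (M₀ η)]
            ext a b
            simp only [matrixIntegral_apply]
            refine integral_congr_ae ?_
            filter_upwards [h3] with ζ hζ
            rw [hζ]
        _ = M₀ η * (L.map fun bk' => matrixIntegral (ymSpecification ρ β bk'.1 η) bk'.2).prod := by
            rw [matrixIntegral_prod_eq_prod hρ β Λ L (fun bk' h' => hsub bk' (List.mem_cons_of_mem _ h'))
              hdisj.2 (fun bk' h' => hcol bk' (List.mem_cons_of_mem _ h'))
              (fun bk' h' => hcont bk' (List.mem_cons_of_mem _ h'))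
              (fun bk' h' => hbd bk' (List.mem_cons_of_mem _ h'))
              (fun bk' h' => hsupp bk' (List.mem_cons_of_mem _ h')) η]
        _ = ((bk :: L).map fun bk' => matrixIntegral (ymSpecification ρ β bk'.1 η) bk'.2).prod := by
            simp only [List.map_cons, List.prod_cons, hM₀_def, hΛ₀, hB₀]

end Factorisation

/-! ### The slab blocks of the tall box and their geometry -/

section Blocks

variable {d : ℕ} [NeZero d]

/-- Base point of the `k`-th slab block of thickness `n` above the lateral centre `x + R eᵢ`:
`x + R eᵢ + k n e₀` (the printed translate of `S_R` through whose centre the right vertical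
side of the loop passes, cut into slabs `S_1, …, S_q` of thickness `N`). [cite: Chatterjee2021, §3 (proof of Thm 2.2)] -/
def slabBlockBase (x : Site d) (i : Fin d) (R n k : ℕ) : Site d :=
  x + Pi.single i (R : ℤ) + Pi.single 0 ((k * n : ℕ) : ℤ)

/-- The resampled edges of the `k`-th slab block: the translate of `slabBox n R` to the base
point `slabBlockBase x i R n k`. [cite: Chatterjee2021, §3 (the slabs S_i)] -/
def blockEdges (x : Site d) (i : Fin d) (R n k : ℕ) : Finset (ZdEdge d) :=
  (slabBox n R).map (edgeShift (slabBlockBase x i R n k)).toEmbedding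

/-- All resampled edges: the union of the first `q` slab blocks (the interior of the tall box
minus the faces `F_1, …, F_q`; the partial top slab is kept frozen). [cite: Chatterjee2021, §3 (Lemma 3.2, proof)] -/
def blocksUnion (x : Site d) (i : Fin d) (R n q : ℕ) : Finset (ZdEdge d) :=
  (Finset.range q).biUnion fun k => blockEdges x i R n k

/-- Height of the `k`-th base point: `x₀ + k n` (for a lateral direction `i ≠ 0`). [folklore] -/
private theorem slabBlockBase_apply_zero (x : Site d) {i : Fin d} (hi : i ≠ 0) (R n k : ℕ) :
    slabBlockBase x i R n k 0 = x 0 + ((k * n : ℕ) : ℤ) := by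
  simp [slabBlockBase, Pi.single_eq_of_ne (Ne.symm hi)]

/-- Lateral `i`-coordinate of the base points: `x_i + R`. [folklore] -/
private theorem slabBlockBase_apply_self (x : Site d) {i : Fin d} (hi : i ≠ 0) (R n k : ℕ) :
    slabBlockBase x i R n k i = x i + R := by
  simp [slabBlockBase, Pi.single_eq_of_ne hi]

/-- Membership in a slab block, through the base slab box. [cite: Chatterjee2021, §3 (the slabs S_i)] -/
theorem mem_blockEdges {x : Site d} {i : Fin d} {R n k : ℕ} {e : ZdEdge d} :
    e ∈ blockEdges x i R n k ↔ (e.1 - slabBlockBase x i R n k, e.2) ∈ slabBox n R := by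
  rw [blockEdges, Finset.mem_map_equiv, edgeShift_symm_apply]

/-- Height window of the edges of the `k`-th block: `x₀ + kn ≤ e₀`, `e₀ + 1 ≤ x₀ + kn + n`, and
strictly above the base for horizontal edges. [cite: Chatterjee2021, §3 (the slabs S_i)] -/
private theorem heights_of_mem_blockEdges {x : Site d} {i : Fin d} (hi : i ≠ 0) {R n k : ℕ}
    {e : ZdEdge d} (he : e ∈ blockEdges x i R n k) :
    x 0 + ((k * n : ℕ) : ℤ) ≤ e.1 0 ∧ e.1 0 + 1 ≤ x 0 + ((k * n : ℕ) : ℤ) + n ∧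
      (e.2 ≠ 0 → x 0 + ((k * n : ℕ) : ℤ) < e.1 0) := by
  have h := (mem_slabBox.1 (mem_blockEdges.1 he)).1
  simp only [IsSlabInteriorEdge, Pi.sub_apply, slabBlockBase_apply_zero x hi] at h
  rcases h with ⟨h0, h1, h2⟩ | ⟨h0, h1, h2⟩
  · exact ⟨by omega, by omega, fun h => absurd h0 h⟩
  · exact ⟨by omega, by omega, fun _ => by omega⟩

/-- Lateral window: an edge of a block has `i`-coordinate within `R − 1` of `x_i + R`; in
particular it is not `x_i`. [cite: Chatterjee2021, §3 (the slabs S_i)] -/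
private theorem apply_ne_of_mem_blockEdges {x : Site d} {i : Fin d} (hi : i ≠ 0) {R n k : ℕ}
    {e : ZdEdge d} (he : e ∈ blockEdges x i R n k) : e.1 i ≠ x i := by
  have h := (mem_slabBox.1 (mem_blockEdges.1 he)).2.1 i hi
  simp only [Pi.sub_apply, slabBlockBase_apply_self x hi] at h
  intro heq
  rw [heq] at h
  have : |x i - (x i + (R : ℤ))| = R := by
    rw [sub_add_cancel_left, abs_neg, abs_of_nonneg (by positivity)]
  omega

/-- From `k n < k' n + n` conclude `k ≤ k'`. [folklore] -/
private theorem le_of_mul_lt {k k' n : ℕ} (h : ((k * n : ℕ) : ℤ) < ((k' * n : ℕ) : ℤ) + n) : k ≤ k' := by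
  have h' : k * n < (k' + 1) * n := by push_cast at h; rw [Nat.add_mul, one_mul]; omega
  exact Nat.lt_succ_iff.1 (Nat.lt_of_mul_lt_mul_right h')

/-- Distinct slab blocks are disjoint (their height windows are). [cite: Chatterjee2021, §3 (the slabs S_i)] -/
theorem disjoint_blockEdges {x : Site d} {i : Fin d} (hi : i ≠ 0) {R n k k' : ℕ} (hkk' : k ≠ k') :
    Disjoint (blockEdges x i R n k) (blockEdges x i R n k') := by
  rw [Finset.disjoint_left]
  intro e he he'
  obtain ⟨h1, h2, -⟩ := heights_of_mem_blockEdges hi he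
  obtain ⟨h1', h2', -⟩ := heights_of_mem_blockEdges hi he'
  have hk : k ≤ k' := le_of_mul_lt (n := n) (by omega)
  have hk' : k' ≤ k := le_of_mul_lt (n := n) (by omega)
  exact hkk' (le_antisymm hk hk')

/-- Heights of the corners of a plaquette: every edge `e'` of the plaquette `(y, {i₁ < j₁})` has
`y₀ ≤ e'₀` and `e'₀ + [e' vertical] ≤ y₀ + [i₁ = 0]`; if `i₁ ≠ 0` the plaquette is horizontal.
[folklore] -/
private theorem heights_of_mem_plaquetteEdges (y : Site d) {i₁ j₁ : Fin d} (hij : i₁ < j₁)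
    {e' : ZdEdge d} (he' : e' ∈ plaquetteEdges (⟨y, ⟨(i₁, j₁), hij⟩⟩ : ZdPlaquette d)) :
    y 0 ≤ e'.1 0 ∧
      e'.1 0 + (if e'.2 = 0 then (1 : ℤ) else 0) ≤ y 0 + (if i₁ = 0 then (1 : ℤ) else 0) ∧
      (i₁ ≠ 0 → e'.2 ≠ 0) := by
  have hj₁ : j₁ ≠ 0 := (lt_of_le_of_lt (Fin.zero_le _) hij).ne'
  simp only [plaquetteEdges, Finset.mem_insert, Finset.mem_singleton] at he'
  by_cases hi₁ : i₁ = 0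
  · subst hi₁
    rcases he' with rfl | rfl | rfl | rfl <;> simp [hj₁]
  · rcases he' with rfl | rfl | rfl | rfl <;> simp [hj₁, hi₁]

/-- The edges of a plaquette touching the `k`-th block stay in its closed height window.
[cite: Chatterjee2021, §3 (Lemma 3.2, proof)] -/
private theorem collar_heights {x : Site d} {i : Fin d} (hi : i ≠ 0) {R n k : ℕ}
    {p : ZdPlaquette d} {e e' : ZdEdge d} (he : e ∈ plaquetteEdges p)
    (heb : e ∈ blockEdges x i R n k) (he' : e' ∈ plaquetteEdges p) :
    x 0 + ((k * n : ℕ) : ℤ) ≤ e'.1 0 ∧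
      e'.1 0 + (if e'.2 = 0 then (1 : ℤ) else 0) ≤ x 0 + ((k * n : ℕ) : ℤ) + n := by
  obtain ⟨y, ⟨⟨i₁, j₁⟩, hij⟩⟩ := p
  obtain ⟨ha, hb, hc⟩ := heights_of_mem_plaquetteEdges y hij he
  obtain ⟨ha', hb', hc'⟩ := heights_of_mem_plaquetteEdges y hij he'
  obtain ⟨h1, h2, h3⟩ := heights_of_mem_blockEdges hi heb
  by_cases hi₁ : i₁ = 0
  · simp only [hi₁, if_true] at hb hb'
    by_cases he0 : e.2 = 0
    · simp only [he0, if_true] at hb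
      constructor
      · omega
      · split_ifs at hb' ⊢ <;> omega
    · simp only [he0, if_false] at hb
      have := h3 he0
      constructor
      · omega
      · split_ifs at hb' ⊢ <;> omega
  · have hne := hc hi₁
    have hne' := hc' hi₁
    simp only [hi₁, if_false, hne, hne'] at hb hb' ⊢
    have := h3 hne
    constructor <;> omega

/-- **Frozen layers separate the blocks**: an edge of a plaquette touching the `k`-th block which
is resampled at all (lies in some block `k' < q`) lies in the `k`-th block. [cite: Chatterjee2021, §3 (Lemma 3.2, proof)] -/
theorem mem_blockEdges_of_mem_collar {x : Site d} {i : Fin d} (hi : i ≠ 0) {R n q k : ℕ}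
    {e' : ZdEdge d} (he' : e' ∈ (plaquettesTouching (blockEdges x i R n k)).biUnion plaquetteEdges)
    (hU : e' ∈ blocksUnion x i R n q) : e' ∈ blockEdges x i R n k := by
  obtain ⟨p, hp, he'p⟩ := Finset.mem_biUnion.1 he'
  obtain ⟨e, he⟩ := mem_plaquettesTouching_iff.1 hp
  rw [Finset.mem_inter] at he
  obtain ⟨k', -, hk'⟩ := Finset.mem_biUnion.1 hU
  obtain ⟨c1, c2⟩ := collar_heights hi he.1 he.2 he'p
  obtain ⟨m1, m2, m3⟩ := heights_of_mem_blockEdges hi hk'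
  suffices hkk : k = k' by rwa [hkk]
  by_cases hv : e'.2 = 0
  · simp only [hv, if_true] at c2
    exact le_antisymm (le_of_mul_lt (n := n) (by omega)) (le_of_mul_lt (n := n) (by omega))
  · simp only [hv, if_false, add_zero] at c2
    have := m3 hv
    exact le_antisymm (le_of_mul_lt (n := n) (by omega)) (le_of_mul_lt (n := n) (by omega))

/-- Edges at height `≥ x₀ + q n` are not resampled. [cite: Chatterjee2021, §3 (Lemma 3.2, proof)] -/
theorem not_mem_blocksUnion_of_height_ge {x : Site d} {i : Fin d} (hi : i ≠ 0) {R n q : ℕ}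
    {e : ZdEdge d} (he : x 0 + ((q * n : ℕ) : ℤ) ≤ e.1 0) : e ∉ blocksUnion x i R n q := by
  intro hU
  obtain ⟨k, hk, hke⟩ := Finset.mem_biUnion.1 hU
  obtain ⟨-, h2, -⟩ := heights_of_mem_blockEdges hi hke
  have hk' : k + 1 ≤ q := Finset.mem_range.1 hk
  have : ((k * n : ℕ) : ℤ) + n ≤ ((q * n : ℕ) : ℤ) := by
    have := Nat.mul_le_mul_right n hk'
    rw [Nat.add_mul, one_mul] at this
    exact_mod_cast this
  omega

/-- Horizontal edges at height `≤ x₀` (the bottom face) are not resampled. [cite: Chatterjee2021, §3 (Lemma 3.2, proof)] -/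
theorem not_mem_blocksUnion_of_horizontal {x : Site d} {i : Fin d} (hi : i ≠ 0) {R n q : ℕ}
    {e : ZdEdge d} (hv : e.2 ≠ 0) (he : e.1 0 ≤ x 0) : e ∉ blocksUnion x i R n q := by
  intro hU
  obtain ⟨k, -, hke⟩ := Finset.mem_biUnion.1 hU
  have := (heights_of_mem_blockEdges hi hke).2.2 hv
  omega

/-- Edges whose `i`-coordinate is `x_i` (the left vertical side) are not resampled. [cite: Chatterjee2021, §3 (proof of Thm 2.2)] -/
theorem not_mem_blocksUnion_of_apply_eq {x : Site d} {i : Fin d} (hi : i ≠ 0) {R n q : ℕ}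
    {e : ZdEdge d} (he : e.1 i = x i) : e ∉ blocksUnion x i R n q := by
  intro hU
  obtain ⟨k, -, hke⟩ := Finset.mem_biUnion.1 hU
  exact apply_ne_of_mem_blockEdges hi hke he

/-- The column of the `k`-th block lies in the `k`-th block (for `R ≥ 1`). [cite: Chatterjee2021, §3 («vertical chain passing through the center of S»)] -/
theorem colEdges_subset_blockEdges (x : Site d) (i : Fin d) {R : ℕ} (hR : 1 ≤ R) (n k : ℕ) :
    colEdges (slabBlockBase x i R n k) n ⊆ blockEdges x i R n k := by
  intro e he
  obtain ⟨t, ht, rfl⟩ := mem_colEdges.1 he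
  rw [mem_blockEdges]
  simp only [add_sub_cancel_left]
  exact colEdges_zero_subset_slabBox hR (mem_colEdges.2 ⟨t, ht, by simp⟩)

end Blocks

/-! ### Holonomies of straight walks and rectangles: supports and symmetries -/

section Walks

variable {d : ℕ} {G : Type*} [Group G]

/-- The ordered product `U_{(y,i)} U_{(y+eᵢ,i)} ⋯ U_{(y+(n−1)eᵢ,i)}` of the link variables along the
straight walk of `n` steps in direction `i` from `y` — the holonomy of `lineWalk i n y`, as a
plain function of the base point. [cite: Wilson1974] -/
def lineHol (U : LGConfig d G) (i : Fin d) : ℕ → Site d → G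
  | 0, _ => 1
  | n + 1, y => U (y, i) * lineHol U i n (y + Pi.single i 1)

/-- `lineHol U i 0 y = 1`. [cite: Wilson1974] -/
@[simp] theorem lineHol_zero (U : LGConfig d G) (i : Fin d) (y : Site d) : lineHol U i 0 y = 1 := rfl

/-- `lineHol U i (n+1) y = U_{(y,i)} · lineHol U i n (y + eᵢ)`. [cite: Wilson1974] -/
theorem lineHol_succ (U : LGConfig d G) (i : Fin d) (n : ℕ) (y : Site d) :
    lineHol U i (n + 1) y = U (y, i) * lineHol U i n (y + Pi.single i 1) := rfl

/-- The holonomy of a straight walk is `lineHol`. [cite: Wilson1974] -/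
theorem walkHolonomy_lineWalk (U : LGConfig d G) (i : Fin d) :
    ∀ (n : ℕ) (y : Site d), walkHolonomy U (lineWalk i n y) = lineHol U i n y
  | 0, y => by simp [lineWalk]
  | n + 1, y => by
      rw [lineWalk, walkHolonomy_cons, walkHolonomy_copy, dartHolonomy_add_single,
        walkHolonomy_lineWalk U i n, lineHol_succ]

/-- The holonomy of the rectangular walk in terms of its four sides:
`U(ℓ) = U(A) U(B) U(C)⁻¹ U(D)⁻¹`. [cite: Wilson1974] -/
theorem walkHolonomy_rectWalk (U : LGConfig d G) (x : Site d) (i j : Fin d) (R T : ℕ) :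
    walkHolonomy U (rectWalk x i j R T) =
      lineHol U i R x * lineHol U j T (x + Pi.single i (R : ℤ)) *
        (lineHol U i R (x + Pi.single j (T : ℤ)))⁻¹ * (lineHol U j T x)⁻¹ := by
  simp only [rectWalk, walkHolonomy_append, walkHolonomy_copy, walkHolonomy_reverse,
    walkHolonomy_lineWalk, mul_assoc]

/-- `lineHol` only sees the links along the walk. [folklore] -/
private theorem lineHol_congr {U V : LGConfig d G} (i : Fin d) :
    ∀ (n : ℕ) (y : Site d),
      (∀ s : ℕ, s < n → U (y + Pi.single i (s : ℤ), i) = V (y + Pi.single i (s : ℤ), i)) →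
        lineHol U i n y = lineHol V i n y
  | 0, _, _ => rfl
  | n + 1, y, h => by
      rw [lineHol_succ, lineHol_succ]
      have h0 := h 0 (Nat.succ_pos n)
      simp only [Nat.cast_zero, Pi.single_zero, add_zero] at h0
      rw [h0, lineHol_congr i n (y + Pi.single i 1) fun s hs => ?_]
      have := h (s + 1) (Nat.succ_lt_succ hs)
      rwa [Nat.cast_succ, add_comm (s : ℤ) 1, Pi.single_add, ← add_assoc] at this

/-- `lineHol` depends continuously on the configuration. [folklore] -/
private theorem continuous_lineHol [TopologicalSpace G] [IsTopologicalGroup G] (i : Fin d) :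
    ∀ (n : ℕ) (y : Site d), Continuous fun U : LGConfig d G => lineHol U i n y
  | 0, y => by simp only [lineHol_zero]; exact continuous_const
  | n + 1, y => by
      simp only [lineHol_succ]
      exact (continuous_apply _).mul (continuous_lineHol i n _)

/-- Straight-walk holonomies are translation covariant: `(θ_v U)(y + v → ⋯) = U(y → ⋯)`. [cite: Georgii2011, §5.1 (5.3)] -/
theorem lineHol_configShift [MeasurableSpace G] (v : Site d) (U : LGConfig d G) (i : Fin d) :
    ∀ (n : ℕ) (y : Site d), lineHol (configShift v U) i n (y + v) = lineHol U i n y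
  | 0, y => rfl
  | n + 1, y => by
      rw [lineHol_succ, lineHol_succ, configShift_apply, add_sub_cancel_right, add_right_comm,
        lineHol_configShift v U i n]

/-- Rectangle holonomies are translation covariant. [cite: Georgii2011, §5.1 (5.3)] -/
theorem walkHolonomy_configShift_rectWalk [MeasurableSpace G] (v : Site d) (U : LGConfig d G)
    (x : Site d) (i j : Fin d) (R T : ℕ) :
    walkHolonomy (configShift v U) (rectWalk (x + v) i j R T) = walkHolonomy U (rectWalk x i j R T) := by
  rw [walkHolonomy_rectWalk, walkHolonomy_rectWalk, add_right_comm x v (Pi.single i (R : ℤ)),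
    add_right_comm x v (Pi.single j (T : ℤ)), lineHol_configShift, lineHol_configShift,
    lineHol_configShift, lineHol_configShift]

/-- Straight-walk holonomies are covariant under coordinate permutations. [cite: SeilerLNP1982, Ch. 2 (hypercubic symmetry of the Wilson action)] -/
theorem lineHol_relabel_edgePerm [MeasurableSpace G] (σ : Equiv.Perm (Fin d)) (U : LGConfig d G)
    (i : Fin d) : ∀ (n : ℕ) (y : Site d),
      lineHol (relabelConfig (edgePerm σ) U) (σ i) n (sitePerm σ y) = lineHol U i n y
  | 0, y => rfl
  | n + 1, y => by
      rw [lineHol_succ, lineHol_succ, relabelConfig_apply, edgePerm_symm_apply, ← sitePerm_symm,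
        Equiv.symm_apply_apply, Equiv.symm_apply_apply, ← sitePerm_single σ i 1, ← sitePerm_add,
        lineHol_relabel_edgePerm σ U i n]

/-- Rectangle holonomies are covariant under coordinate permutations. [cite: SeilerLNP1982, Ch. 2 (hypercubic symmetry of the Wilson action)] -/
theorem walkHolonomy_relabel_edgePerm_rectWalk [MeasurableSpace G] (σ : Equiv.Perm (Fin d))
    (U : LGConfig d G) (x : Site d) (i j : Fin d) (R T : ℕ) :
    walkHolonomy (relabelConfig (edgePerm σ) U) (rectWalk (sitePerm σ x) (σ i) (σ j) R T) =
      walkHolonomy U (rectWalk x i j R T) := by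
  rw [walkHolonomy_rectWalk, walkHolonomy_rectWalk, ← sitePerm_single σ i, ← sitePerm_single σ j,
    ← sitePerm_add, ← sitePerm_add, lineHol_relabel_edgePerm, lineHol_relabel_edgePerm,
    lineHol_relabel_edgePerm, lineHol_relabel_edgePerm]

variable {m : ℕ} [NeZero d] (π : G →* Matrix (Fin m) (Fin m) ℂ)

/-- The represented vertical straight-walk holonomy is the column matrix. [cite: Chatterjee2021, §3 (vertical chain variables)] -/
theorem map_lineHol_zero (U : LGConfig d G) :
    ∀ (n : ℕ) (y : Site d), π (lineHol U 0 n y) = colMat π U y n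
  | 0, y => by simp
  | n + 1, y => by rw [lineHol_succ, map_mul, map_lineHol_zero U n, colMat_succ]

/-- Trace cyclicity for the rectangle: `tr π(A B C⁻¹ D⁻¹) = tr(π(B) π(C⁻¹ D⁻¹ A))`. [folklore] -/
private theorem trace_map_rect (A B C D : G) :
    (π (A * B * C⁻¹ * D⁻¹)).trace = (π B * π (C⁻¹ * D⁻¹ * A)).trace := by
  rw [show A * B * C⁻¹ * D⁻¹ = A * (B * (C⁻¹ * D⁻¹)) by group, map_mul, Matrix.trace_mul_comm,
    ← map_mul, show B * (C⁻¹ * D⁻¹) * A = B * (C⁻¹ * D⁻¹ * A) by group, map_mul]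

omit [Group G] [NeZero d] in
/-- `θ_v θ_{−v} = id` on configurations. [folklore] -/
private theorem configShift_configShift_neg [MeasurableSpace G] (v : Site d) (η : LGConfig d G) :
    configShift v (configShift (-v) η) = η := by
  funext e
  simp only [configShift_apply, sub_neg_eq_add, sub_add_cancel, Prod.mk.eta]

/-- Columns of `q` blocks: `col(U; y, q n) = ∏_{k<q} col(U; y + k n e₀, n)`. [cite: Chatterjee2021, §3 (Lemma 3.2, proof)] -/
theorem colMat_mul_eq_prod (U : LGConfig d G) (y : Site d) (n : ℕ) :
    ∀ q : ℕ, colMat π U y (q * n) =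
      ((List.range q).map fun k => colMat π U (y + Pi.single 0 ((k * n : ℕ) : ℤ)) n).prod
  | 0 => by simp
  | q + 1 => by
      rw [Nat.succ_mul, colMat_add, colMat_mul_eq_prod U y n q, List.range_succ, List.map_append,
        List.prod_append, List.map_singleton, List.prod_singleton]

end Walks

/-! ### The main bound for loops with vertical side of length `T ≥ N` -/

section MainBound

variable {d N m : ℕ} [NeZero d] {G : Type*} [Group G] [TopologicalSpace G] [IsTopologicalGroup G]
  [CompactSpace G] [T2Space G] [SecondCountableTopology G] [MeasurableSpace G] [BorelSpace G]
  (ρ : G →* Matrix (Fin N) (Fin N) ℂ) (π : G →* Matrix (Fin m) (Fin m) ℂ)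

omit [T2Space G] in
/-- **Translation covariance of the block kernels**: the kernel expectation of the `k`-th column
block with boundary condition `η` is the base-slab kernel expectation of the column through the
origin with the translated boundary condition (Lemma 3.1 is applied to «a vertical chain passing
through the center of `S`» of each translated slab). [cite: Chatterjee2021, §3 (Lemma 3.2, proof)] -/
theorem integral_blockObs_eq (hρ : Continuous ρ) (hπ : Continuous π) (β : ℝ) (x : Site d) (i : Fin d)
    (R n k : ℕ) (η : LGConfig d G) (a b : Fin m) :
    ∫ U, colMat π U (slabBlockBase x i R n k) n a b ∂(ymSpecification ρ β (blockEdges x i R n k) η) =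
      ∫ U, colMat π U 0 n a b
        ∂(ymSpecification ρ β (slabBox n R) (configShift (-slabBlockBase x i R n k) η)) := by
  set v := slabBlockBase x i R n k
  have hcont : Continuous fun U : LGConfig d G => colMat π U v n a b :=
    (continuous_apply b).comp ((continuous_apply a).comp (continuous_colMat π hπ n v))
  conv_lhs => rw [← configShift_configShift_neg v η]
  rw [blockEdges, ← ymSpecification_map_configShift ρ hρ β v,
    integral_map (configShift v).measurable.aemeasurable hcont.aestronglyMeasurable]
  refine integral_congr_ae (ae_of_all _ fun U => ?_)
  have := colMat_configShift π v U n 0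
  rw [zero_add] at this
  simp only [this]

/-- **Chatterjee 2021, proof of Theorem 2.2 (with Lemma 3.2): the bound for one loop.** For a
lattice Yang–Mills DLR state `μ`, a rectangular loop with horizontal side `R ≥ 1` in a lateral
direction `i ≠ 0` and vertical side `T` in direction `0`, and any `s ≥ 0` bounding the
base-slab column kernels `|γ_{S_R}(col_{ab} | η)| ≤ s` uniformly in `η` (Lemma 3.1 supplies
`s = e^{−V(R)}`): `|⟨tr π(U_ℓ)⟩_μ| ≤ m^{[T/n]+2} s^{[T/n]}` (printed: `m^{2(R+T)} e^{−V(R)[T/N]}`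
from `m^{2(R+T)}` component variables; here the `m × m` matrix bookkeeping gives `m^{q+2}`).
Proof as printed: write `tr π(U_ℓ) = tr(col(U; x+Reᵢ, T) · Z)` with `Z` unitary on frozen links;
condition on everything outside the `q = [T/n]` slab blocks of the translate of
`{0,…,T} × {−R,…,R}^{d−1}` centred on the right vertical side (DLR); the blocks are independent
given the faces (`matrixIntegral_prod_eq_prod`), each block kernel is a translate of the base
slab (`integral_blockObs_eq`) and so has entries `≤ s`; entries of unitaries are `≤ 1`.
[cite: Chatterjee2021, Thm. 2.2 (proof) and Lemma 3.2] -/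
theorem norm_integral_trace_rect_le (hρ : Continuous ρ) (hπ : Continuous π)
    (hπu : ∀ g, π g ∈ Matrix.unitaryGroup (Fin m) ℂ) (β : ℝ) (n : ℕ) {s : ℝ}
    (hs0 : 0 ≤ s) {R : ℕ} (hR : 1 ≤ R)
    (hs : ∀ (η : LGConfig d G) (a b : Fin m),
      ‖∫ U, colMat π U 0 n a b ∂(ymSpecification ρ β (slabBox n R) η)‖ ≤ s)
    {μ : Measure (LGConfig d G)} (hμ : μ ∈ ymGibbsMeasures ρ β) (x : Site d) {i : Fin d} (hi : i ≠ 0)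
    (T : ℕ) :
    ‖∫ U, (π (walkHolonomy U (rectWalk x i 0 R T))).trace ∂μ‖ ≤
      (m : ℝ) ^ (T / n + 2) * s ^ (T / n) := by
  have hγ := QuantumFieldTheory.isSpecification_ymSpecification_of_t2Space (d := d) ρ hρ β
  haveI : ∀ (Λ' : Finset (ZdEdge d)) (ζ : LGConfig d G),
      IsProbabilityMeasure (ymSpecification ρ β Λ' ζ) := isProbabilityMeasure_ymSpecification ρ hρ β
  haveI : IsProbabilityMeasure μ := hμ.1
  -- arithmetic of the decomposition `T = q n + r`
  set q := T / n with hq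
  set r := T % n with hr
  have hTqr : T = q * n + r := by rw [hq, hr, mul_comm]; exact (Nat.div_add_mod T n).symm
  -- the pieces of the loop
  set c₀ : Site d := x + Pi.single i (R : ℤ) with hc₀
  set Λ := blocksUnion x i R n q with hΛ
  set L : List (Finset (ZdEdge d) × (LGConfig d G → Matrix (Fin m) (Fin m) ℂ)) :=
    (List.range q).map fun k => (blockEdges x i R n k, fun U => colMat π U (slabBlockBase x i R n k) n)
    with hL
  set PB : LGConfig d G → Matrix (Fin m) (Fin m) ℂ := fun U => (L.map fun bk => bk.2 U).prod with hPB
  set Qm : LGConfig d G → Matrix (Fin m) (Fin m) ℂ := fun U =>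
    colMat π U (c₀ + Pi.single 0 ((q * n : ℕ) : ℤ)) r with hQm
  set Z : LGConfig d G → Matrix (Fin m) (Fin m) ℂ := fun U =>
    π ((lineHol U i R (x + Pi.single 0 (T : ℤ)))⁻¹ * (lineHol U 0 T x)⁻¹ * lineHol U i R x) with hZ
  set Y : LGConfig d G → Matrix (Fin m) (Fin m) ℂ := fun U => Qm U * Z U with hY
  set W : LGConfig d G → ℂ := fun U => (π (walkHolonomy U (rectWalk x i 0 R T))).trace with hW
  -- `PB U` is the product of the block columns
  have hPB_eq : ∀ U, PB U = colMat π U c₀ (q * n) := fun U => by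
    simp only [hPB, hL, List.map_map, colMat_mul_eq_prod]
    rfl
  -- Step 1: `W = tr(PB · Y)`
  have hcol : ∀ U, colMat π U c₀ T = PB U * Qm U := fun U => by
    rw [hPB_eq]
    conv_lhs => rw [hTqr]
    rw [colMat_add]
  have hW_eq : ∀ U, W U = (PB U * Y U).trace := by
    intro U
    simp only [hW, hY, hZ]
    rw [walkHolonomy_rectWalk, trace_map_rect, map_lineHol_zero, hcol, mul_assoc]
  -- continuity and bounds
  have hent : ∀ {F : LGConfig d G → Matrix (Fin m) (Fin m) ℂ}, Continuous F →
      ∀ a b, Continuous fun U => F U a b := fun hF a b =>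
    (continuous_apply b).comp ((continuous_apply a).comp hF)
  have hLc : ∀ bk ∈ L, Continuous bk.2 := by
    intro bk hbk
    obtain ⟨k, -, rfl⟩ := List.mem_map.1 hbk
    exact continuous_colMat π hπ n _
  have hLbd : ∀ bk ∈ L, ∀ U a b, ‖bk.2 U a b‖ ≤ 1 := by
    intro bk hbk U a b
    obtain ⟨k, -, rfl⟩ := List.mem_map.1 hbk
    exact norm_colMat_apply_le_one π hπu U _ n a b
  have hPBc : Continuous PB := continuous_list_prod L hLc
  have hZc : Continuous Z := by
    simp only [hZ]
    refine hπ.comp ?_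
    exact (((continuous_lineHol i R _).inv).mul (continuous_lineHol 0 T _).inv).mul
      (continuous_lineHol i R _)
  have hYc : Continuous Y := (continuous_colMat π hπ r _).matrix_mul hZc
  have hYu : ∀ U, Y U ∈ Matrix.unitaryGroup (Fin m) ℂ := fun U =>
    mul_mem (colMat_mem_unitaryGroup π hπu U r _) (hπu _)
  have hYbd : ∀ U a b, ‖Y U a b‖ ≤ 1 := fun U => entry_norm_bound_of_unitary (hYu U)
  have hPBu : ∀ U, PB U ∈ Matrix.unitaryGroup (Fin m) ℂ := fun U => by
    rw [hPB_eq]; exact colMat_mem_unitaryGroup π hπu U _ _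
  have hWc : Continuous W := by
    simp only [funext hW_eq]
    exact (hPBc.matrix_mul hYc).matrix_trace
  have hWbd : ∀ U, ‖W U‖ ≤ m * 1 := fun U => by
    rw [hW_eq]
    exact norm_trace_le (entry_norm_bound_of_unitary (mul_mem (hPBu U) (hYu U)))
  -- Step 2: DLR
  have h2 : ∫ U, W U ∂μ = ∫ η, (∫ U, W U ∂(ymSpecification ρ β Λ η)) ∂μ :=
    (integral_integral_eq_vec hγ hμ Λ (integrable_of_norm_le hWc hWbd)).symm
  -- Step 3: the inner integral factorises
  have hY_frozen : ∀ η, ∀ᵐ U ∂(ymSpecification ρ β Λ η), Y U = Y η := by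
    intro η
    have hqnT : ((q * n : ℕ) : ℤ) ≤ (T : ℤ) := by exact_mod_cast Nat.div_mul_le_self T n
    have hi' : (0 : Fin d) ≠ i := Ne.symm hi
    filter_upwards [hγ.proper Λ η] with U hU
    have e1 : Qm U = Qm η := by
      simp only [hQm]
      refine colMat_congr π r _ fun t _ => hU _ (not_mem_blocksUnion_of_height_ge hi ?_)
      simp [hc₀, Pi.single_eq_of_ne hi']
    have e2 : lineHol U i R (x + Pi.single 0 (T : ℤ)) = lineHol η i R (x + Pi.single 0 (T : ℤ)) := by
      refine lineHol_congr i R _ fun t _ => hU _ (not_mem_blocksUnion_of_height_ge hi ?_)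
      simp [Pi.single_eq_of_ne hi']
      exact hqnT
    have e3 : lineHol U 0 T x = lineHol η 0 T x := by
      refine lineHol_congr 0 T _ fun t _ => hU _ (not_mem_blocksUnion_of_apply_eq hi ?_)
      simp [Pi.single_eq_of_ne hi]
    have e4 : lineHol U i R x = lineHol η i R x := by
      refine lineHol_congr i R _ fun t _ => hU _ (not_mem_blocksUnion_of_horizontal hi hi ?_)
      simp [Pi.single_eq_of_ne hi']
    simp only [hY, hZ, e1, e2, e3, e4]
  have h3 : ∀ η, ∫ U, W U ∂(ymSpecification ρ β Λ η) =
      ((L.map fun bk => matrixIntegral (ymSpecification ρ β bk.1 η) bk.2).prod * Y η).trace := by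
    intro η
    have hPBint : ∀ a b, Integrable (fun U => PB U a b) (ymSpecification ρ β Λ η) := fun a b =>
      integrable_of_norm_le (hent hPBc a b) fun U => entry_norm_bound_of_unitary (hPBu U) a b
    have hprodint : ∀ a b, Integrable (fun U => (PB U * Y U) a b) (ymSpecification ρ β Λ η) :=
      fun a b => integrable_of_norm_le (hent (hPBc.matrix_mul hYc) a b) fun U =>
        entry_norm_bound_of_unitary (mul_mem (hPBu U) (hYu U)) a b
    simp only [hW_eq]
    rw [integral_trace_eq _ hprodint, matrixIntegral_mul_of_ae_eq _ hPBint (hY_frozen η),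
      matrixIntegral_prod_eq_prod ρ hρ β Λ L ?_ ?_ ?_ hLc hLbd ?_ η]
    · intro bk hbk
      obtain ⟨k, hk, rfl⟩ := List.mem_map.1 hbk
      exact Finset.subset_biUnion_of_mem (fun k => blockEdges x i R n k) (by simpa using hk)
    · rw [hL, List.pairwise_map]
      exact List.Pairwise.imp (fun hkk' => disjoint_blockEdges hi hkk') List.nodup_range
    · intro bk hbk e he heΛ
      obtain ⟨k, -, rfl⟩ := List.mem_map.1 hbk
      exact mem_blockEdges_of_mem_collar hi he heΛ
    · intro bk hbk a b
      obtain ⟨k, -, rfl⟩ := List.mem_map.1 hbk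
      intro U V hUV
      exact isCylinder_colMat_apply π _ n a b fun e he =>
        hUV e (Finset.mem_coe.2 (colEdges_subset_blockEdges x i hR n k (Finset.mem_coe.1 he)))
  -- Step 4: entry bounds
  have h4 : ∀ η, ‖∫ U, W U ∂(ymSpecification ρ β Λ η)‖ ≤ (m : ℝ) ^ (q + 2) * s ^ q := by
    intro η
    rw [h3 η]
    have hM : ∀ X ∈ L.map (fun bk => matrixIntegral (ymSpecification ρ β bk.1 η) bk.2),
        ∀ a b, ‖X a b‖ ≤ s := by
      intro X hX a b
      obtain ⟨bk, hbk, rfl⟩ := List.mem_map.1 hX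
      obtain ⟨k, -, rfl⟩ := List.mem_map.1 hbk
      simp only [matrixIntegral_apply]
      rw [integral_blockObs_eq ρ π hρ hπ β x i R n k η a b]
      exact hs _ a b
    have hprod := norm_list_prod_apply_le hs0 _ hM
    have hLlen : (L.map fun bk => matrixIntegral (ymSpecification ρ β bk.1 η) bk.2).length = q := by
      simp [hL]
    rw [hLlen] at hprod
    calc ‖((L.map fun bk => matrixIntegral (ymSpecification ρ β bk.1 η) bk.2).prod * Y η).trace‖
        ≤ m * (m * (((m : ℝ) ^ q * s ^ q) * 1)) := norm_trace_le (norm_mul_apply_le hprod (hYbd η))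
      _ = (m : ℝ) ^ (q + 2) * s ^ q := by ring
  -- Step 5: integrate the bound
  rw [h2]
  have h5 := norm_integral_le_of_norm_le_const (μ := μ)
    (f := fun η => ∫ U, W U ∂(ymSpecification ρ β Λ η)) (C := (m : ℝ) ^ (q + 2) * s ^ q)
    (ae_of_all _ h4)
  simpa using h5

end MainBound

/-! ### Assembly: Theorem 2.2 -/

section Assembly

variable {d N m : ℕ} [NeZero d] {G : Type*} [Group G] [TopologicalSpace G] [IsTopologicalGroup G]
  [CompactSpace G] [T2Space G] [SecondCountableTopology G] [MeasurableSpace G] [BorelSpace G]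
  (ρ : G →* Matrix (Fin N) (Fin N) ℂ) (π : G →* Matrix (Fin m) (Fin m) ℂ)

variable (d) in
/-- `s(R) = sup_{η, a, b} |γ_{S_R}(col(·; 0, n)_{ab} | η)|` — the printed `sup_{f,δ} |⟨f⟩_{R,δ}|`
of Lemma 3.1 (matrix form). [cite: Chatterjee2021, Lemma 3.1 (proof)] -/
def colSup (β : ℝ) (n R : ℕ) : ℝ :=
  ⨆ p : LGConfig d G × (Fin m × Fin m),
    ‖∫ U, colMat π U 0 n p.2.1 p.2.2 ∂(ymSpecification ρ β (slabBox n R) p.1)‖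

omit [T2Space G] in
/-- Each column kernel is bounded by `1`. [cite: Chatterjee2021, Lemma 3.1 (proof)] -/
private theorem norm_colKernel_le_one (hρ : Continuous ρ) (hπu : ∀ g, π g ∈ Matrix.unitaryGroup (Fin m) ℂ)
    (β : ℝ) (n R : ℕ) (η : LGConfig d G) (a b : Fin m) :
    ‖∫ U, colMat π U 0 n a b ∂(ymSpecification ρ β (slabBox n R) η)‖ ≤ 1 := by
  haveI := isProbabilityMeasure_ymSpecification ρ hρ β (slabBox n R) η
  have h := norm_integral_le_of_norm_le_const (μ := ymSpecification ρ β (slabBox n R) η)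
    (f := fun U => colMat π U 0 n a b) (C := 1)
    (ae_of_all _ fun U => norm_colMat_apply_le_one π hπu U 0 n a b)
  simpa using h

omit [T2Space G] in
/-- `|γ_{S_R}(col_{ab} | η)| ≤ s(R)`. [cite: Chatterjee2021, Lemma 3.1 (proof)] -/
theorem norm_colKernel_le_colSup (hρ : Continuous ρ) (hπu : ∀ g, π g ∈ Matrix.unitaryGroup (Fin m) ℂ)
    (β : ℝ) (n R : ℕ) (η : LGConfig d G) (a b : Fin m) :
    ‖∫ U, colMat π U 0 n a b ∂(ymSpecification ρ β (slabBox n R) η)‖ ≤ colSup d ρ π β n R :=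
  le_ciSup (f := fun p : LGConfig d G × (Fin m × Fin m) =>
      ‖∫ U, colMat π U 0 n p.2.1 p.2.2 ∂(ymSpecification ρ β (slabBox n R) p.1)‖)
    ⟨1, by rintro _ ⟨p, rfl⟩; exact norm_colKernel_le_one ρ π hρ hπu β n R _ _ _⟩ (η, (a, b))

omit [T2Space G] in
/-- `0 ≤ s(R) ≤ 1`. [cite: Chatterjee2021, Lemma 3.1 (proof)] -/
theorem colSup_nonneg_le_one (hρ : Continuous ρ) (hπu : ∀ g, π g ∈ Matrix.unitaryGroup (Fin m) ℂ)
    (β : ℝ) (n R : ℕ) : 0 ≤ colSup d ρ π β n R ∧ colSup d ρ π β n R ≤ 1 :=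
  ⟨Real.iSup_nonneg fun _ => norm_nonneg _,
    Real.iSup_le (fun _ => norm_colKernel_le_one ρ π hρ hπu β n R _ _ _) zero_le_one⟩

/-- **Lemma 3.1, supremum form**: `s(R) → 0` («`lim_{R→∞} sup_{f,δ} |⟨f⟩_{R,δ}| = 0`»). [cite: Chatterjee2021, Lemma 3.1] -/
theorem colSup_eventually_le (hρ : Continuous ρ) (hπ : Continuous π)
    (hπu : ∀ g, π g ∈ Matrix.unitaryGroup (Fin m) ℂ) {β : ℝ} {n : ℕ} (hn : 1 ≤ n)
    (hCU : ∀ δ : LGConfig d G, SlabCentreUnbroken ρ β n δ) {g₀ : G}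
    (hg₀ : g₀ ∈ Subgroup.center G) {c : ℂ} (hc : π g₀ = c • (1 : Matrix (Fin m) (Fin m) ℂ))
    (hc1 : c ≠ 1) {ε : ℝ} (hε : 0 < ε) :
    ∃ R₀ : ℕ, ∀ R : ℕ, R₀ ≤ R → colSup d ρ π β n R ≤ ε := by
  obtain ⟨R₀, hR₀⟩ := colKernel_tendsto_zero ρ π hρ hπ hπu hn hCU hg₀ hc hc1 ε hε
  exact ⟨R₀, fun R hR => Real.iSup_le (fun _ => hR₀ R hR _ _ _) hε.le⟩

/-- **Chatterjee 2021, Theorem 2.2** — discharge of the named fact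
`chatterjee2021_confinement_of_centreUnbroken` («unbroken center symmetry implies confinement»):
if the lattice gauge theory has unbroken centre symmetry (Def. 2.1, tree `CentreUnbroken d ρ β`)
and `π` is a finite-dimensional irreducible unitary representation acting non-trivially on the
centre, then there is `V : ℕ → ℝ` with `V(R) → ∞` such that every DLR state satisfies
`|⟨W_ℓ⟩| ≤ e^{−V(R) T}` for all rectangular loops with sides `1 ≤ R ≤ T`.
Proof as printed (op. cit. §3): Schur's lemma gives `π(g₀) = c·1`, `c ≠ 1`; Lemma 3.1
(`colSup_eventually_le`: the column kernels of the finite slabs are uniformly small,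
`s(R) → 0`, by compactness and centre symmetry); Lemma 3.2 and the proof of Thm. 2.2
(`norm_integral_trace_rect_le`: conditioning on the frozen faces of `[T/N]` translated slabs and on
the outside of the box makes the slabs independent, each contributing a factor `≤ m·s(R)`);
`V(R) := −log s(R)` (`:= R` if `s(R) = 0`), and the printed `V₁(R) = V(R)/2N − 4 log m` is used
in the form `V₁(R) = V(R)/2N − 3 log m` for `R ≥ N` and `V₁(R) = −log m` for `R < N` (where the
printed `[x] ≥ x/2`, `x = T/N`, needs `T ≥ N`; for `T < N` only the trivial bound `|⟨W_ℓ⟩| ≤ m`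
is available and is what `V₁(R) = −log m` encodes). Loops in a plane not containing the slab
direction `0`, or with the `T`-side not along `e₀`, are moved by a coordinate permutation, under
which the set of DLR states is invariant (`map_relabel_edgePerm_mem_ymGibbsMeasures`; the printed
proof uses the isotropy of the theory tacitly). [cite: Chatterjee2021, Thm. 2.2] -/
theorem chatterjee2021_confinement_of_centreUnbroken_holds :
    chatterjee2021_confinement_of_centreUnbroken := by
  intro d _ hd G _ _ _ _ _ _ _ _ _ N ρ hρ _hρinj _hρu β hCU m π hπ hπu hirr hg₀
  obtain ⟨g₀, hg₀, hg₀ne⟩ := hg₀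
  obtain ⟨n, hn, hCUn⟩ := hCU
  -- Schur's lemma: `π(g₀) = c • 1` with `c ≠ 1`
  obtain ⟨c, hc⟩ := Literature.Analysis.Convex.SymmetryAdapted.exists_eq_smul_one_of_comm hirr
    (M := π g₀) fun g => by rw [← map_mul, ← map_mul, Subgroup.mem_center_iff.1 hg₀ g]
  have hc1 : c ≠ 1 := fun h => hg₀ne (by rw [hc, h, one_smul])
  have hm : 1 ≤ m := by
    rcases Nat.eq_zero_or_pos m with h | h
    · subst h; exact absurd (Subsingleton.elim _ _) hg₀ne
    · exact h
  have hmR : (1 : ℝ) ≤ m := by exact_mod_cast hm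
  have hmpos : (0 : ℝ) < m := by positivity
  have hn0 : (0 : ℝ) < n := by exact_mod_cast hn
  -- the functions `s`, `V`, `V₁`
  set s : ℕ → ℝ := fun R => colSup d ρ π β n R with hs_def
  have hs01 : ∀ R, 0 ≤ s R ∧ s R ≤ 1 := fun R => colSup_nonneg_le_one ρ π hρ hπu β n R
  set V : ℕ → ℝ := fun R => if s R = 0 then (R : ℝ) else -Real.log (s R) with hV_def
  have hsV : ∀ R, s R ≤ Real.exp (-V R) := fun R => by
    by_cases h0 : s R = 0
    · rw [h0]; exact (Real.exp_pos _).le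
    · simp only [hV_def, h0, if_false, neg_neg]
      rw [Real.exp_log (lt_of_le_of_ne (hs01 R).1 (Ne.symm h0))]
  have hV_tend : Tendsto V atTop atTop := by
    refine tendsto_atTop_atTop.2 fun M => ?_
    obtain ⟨R₁, hR₁⟩ := colSup_eventually_le ρ π hρ hπ hπu hn hCUn hg₀ hc hc1 (Real.exp_pos (-M))
    refine ⟨max R₁ ⌈M⌉₊, fun R hR => ?_⟩
    have hR1 : R₁ ≤ R := le_trans (le_max_left _ _) hR
    have hR2 : ⌈M⌉₊ ≤ R := le_trans (le_max_right _ _) hR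
    by_cases h0 : s R = 0
    · simp only [hV_def, h0, if_true]
      exact le_trans (Nat.le_ceil M) (by exact_mod_cast hR2)
    · simp only [hV_def, h0, if_false]
      have hspos : 0 < s R := lt_of_le_of_ne (hs01 R).1 (Ne.symm h0)
      have := Real.log_le_log hspos (hR₁ R hR1)
      rw [Real.log_exp] at this
      linarith
  set V₁ : ℕ → ℝ := fun R => if R < n then -Real.log m else V R / (2 * n) - 3 * Real.log m
    with hV₁_def
  have hV₁_tend : Tendsto V₁ atTop atTop := by
    refine tendsto_atTop_atTop.2 fun M => ?_
    obtain ⟨R₁, hR₁⟩ := tendsto_atTop_atTop.1 hV_tend ((M + 3 * Real.log m) * (2 * n))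
    refine ⟨max R₁ n, fun R hR => ?_⟩
    have hRn : ¬ R < n := not_lt.2 (le_trans (le_max_right _ _) hR)
    simp only [hV₁_def, hRn, if_false]
    have h := hR₁ R (le_trans (le_max_left _ _) hR)
    have h' : M + 3 * Real.log m ≤ V R / (2 * n) := by
      rw [le_div_iff₀ (by positivity)]; exact h
    linarith
  refine ⟨V₁, hV₁_tend, fun μ hμ x i j hij R T hR hRT => ?_⟩
  haveI : IsProbabilityMeasure μ := hμ.1
  -- the trivial bound `|⟨W_ℓ⟩| ≤ m`
  have htriv : ∀ (μ' : Measure (LGConfig d G)) [IsProbabilityMeasure μ'] (x' : Site d) (i' j' : Fin d),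
      ‖∫ U, (π (walkHolonomy U (rectWalk x' i' j' R T))).trace ∂μ'‖ ≤ m := by
    intro μ' _ x' i' j'
    have h := norm_integral_le_of_norm_le_const (μ := μ')
      (f := fun U => (π (walkHolonomy U (rectWalk x' i' j' R T))).trace) (C := (m : ℝ) * 1)
      (ae_of_all _ fun U => norm_trace_le (entry_norm_bound_of_unitary (hπu _)))
    simpa using h
  by_cases hRn : R < n
  · -- short loops: `V₁ R = -log m`, bound `m ≤ m^T`
    simp only [hV₁_def, hRn, if_true]
    refine (htriv μ x i j).trans ?_
    rw [show -(-Real.log (m : ℝ) * (T : ℝ)) = (T : ℝ) * Real.log m by ring, Real.exp_nat_mul,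
      Real.exp_log hmpos]
    exact le_self_pow₀ hmR (by omega)
  -- long loops: `T ≥ R ≥ n`
  have hRn' : n ≤ R := not_lt.1 hRn
  have hTn : n ≤ T := le_trans hRn' hRT
  simp only [hV₁_def, hRn, if_false]
  set q := T / n with hq
  have hq1 : 1 ≤ q := (Nat.le_div_iff_mul_le hn).2 (by simpa using hTn)
  -- the `j = 0` form of the bound, for every DLR state and base point
  have key : ∀ (μ' : Measure (LGConfig d G)), μ' ∈ ymGibbsMeasures ρ β → ∀ (x' : Site d) {i' : Fin d},
      i' ≠ 0 → ‖∫ U, (π (walkHolonomy U (rectWalk x' i' 0 R T))).trace ∂μ'‖ ≤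
        (m : ℝ) ^ (q + 2) * s R ^ q := fun μ' hμ' x' i' hi' =>
    norm_integral_trace_rect_le ρ π hρ hπ hπu β n (hs01 R).1 hR
      (fun η a b => norm_colKernel_le_colSup ρ π hρ hπu β n R η a b) hμ' x' hi' T
  -- reduce to the `j = 0` form by a coordinate permutation
  have hbound : ‖∫ U, (π (walkHolonomy U (rectWalk x i j R T))).trace ∂μ‖ ≤
      (m : ℝ) ^ (q + 2) * s R ^ q := by
    by_cases hj : j = 0
    · subst hj; exact key μ hμ x hij
    · set σ : Equiv.Perm (Fin d) := Equiv.swap (0 : Fin d) j with hσ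
      have hσj : σ j = 0 := by rw [hσ, Equiv.swap_apply_right]
      have hσi : σ i ≠ 0 := by
        intro h
        apply hij
        have : i = σ.symm 0 := (Equiv.eq_symm_apply σ).2 h
        rw [this, hσ, Equiv.symm_swap, Equiv.swap_apply_left]
      have hΨ : Measurable (relabelConfig (G := G) (edgePerm σ)) := (relabelConfig (edgePerm σ)).measurable
      have hF : Continuous fun U : LGConfig d G =>
          (π (walkHolonomy U (rectWalk (sitePerm σ x) (σ i) (σ j) R T))).trace := by
        simp only [walkHolonomy_rectWalk]
        refine (hπ.comp ?_).matrix_trace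
        exact (((continuous_lineHol _ R _).mul (continuous_lineHol _ T _)).mul
          (continuous_lineHol _ R _).inv).mul (continuous_lineHol _ T _).inv
      have hchange : ∫ U, (π (walkHolonomy U (rectWalk x i j R T))).trace ∂μ =
          ∫ U, (π (walkHolonomy U (rectWalk (sitePerm σ x) (σ i) (σ j) R T))).trace
            ∂(μ.map (relabelConfig (edgePerm σ))) := by
        rw [integral_map hΨ.aemeasurable hF.aestronglyMeasurable]
        simp only [walkHolonomy_relabel_edgePerm_rectWalk]
      rw [hchange, hσj]
      exact key _ (map_relabel_edgePerm_mem_ymGibbsMeasures ρ hρ β σ hμ) _ hσi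
  refine hbound.trans ?_
  -- arithmetic: `m^{q+2} s^q ≤ exp(−(V/(2n) − 3 log m) T) = m^{3T} exp(−V T/(2n))`
  have hexp : Real.exp (-((V R / (2 * n) - 3 * Real.log m) * T)) =
      (m : ℝ) ^ (3 * T) * Real.exp (-(V R / (2 * n) * T)) := by
    rw [show -((V R / (2 * n) - 3 * Real.log m) * T) =
        ((3 * T : ℕ) : ℝ) * Real.log m + -(V R / (2 * n) * T) by push_cast; ring,
      Real.exp_add, Real.exp_nat_mul, Real.exp_log hmpos]
  rw [hexp]
  have hqT : q ≤ T := Nat.div_le_self T n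
  have h1 : (m : ℝ) ^ (q + 2) ≤ (m : ℝ) ^ (3 * T) := pow_le_pow_right₀ hmR (by omega)
  have h2 : s R ^ q ≤ Real.exp (-(V R / (2 * n) * T)) := by
    by_cases h0 : s R = 0
    · rw [h0, zero_pow (by omega)]; exact (Real.exp_pos _).le
    · have hspos : 0 < s R := lt_of_le_of_ne (hs01 R).1 (Ne.symm h0)
      simp only [hV_def, h0, if_false]
      rw [← Real.exp_log hspos, ← Real.exp_nat_mul, Real.log_exp]
      refine Real.exp_le_exp.2 ?_
      rw [show -(-Real.log (s R) / (2 * n) * T) = (T / (2 * n)) * Real.log (s R) by ring]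
      have hlog : Real.log (s R) ≤ 0 := Real.log_nonpos (hs01 R).1 (hs01 R).2
      have hTq : (T : ℝ) / (2 * n) ≤ q := by
        rw [div_le_iff₀ (by positivity)]
        have hmod : T % n < n := Nat.mod_lt T hn
        have hdecomp : n * q + T % n = T := by rw [hq]; exact Nat.div_add_mod T n
        have hnq : n ≤ n * q := Nat.le_mul_of_pos_right n hq1
        have : (T : ℝ) ≤ (q : ℝ) * (2 * n) := by
          have hT2 : T ≤ q * (2 * n) := by nlinarith
          exact_mod_cast hT2
        exact this
      exact mul_le_mul_of_nonpos_right hTq hlog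
  exact mul_le_mul h1 h2 (pow_nonneg (hs01 R).1 q) (pow_nonneg hmpos.le _)

end Assembly

end Literature.MathematicalPhysics.QuantumLattice

end
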